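import Literature.MathematicalPhysics.QuantumFieldTheory.Balaban1983to89.B16RLeafRecord12Live
import Literature.MathematicalPhysics.QuantumFieldTheory.Balaban1983to89.Node00.Record12LiveSelectorTorus

/-!
# `Balaban1983to89.B16RLeafRecord12AtLive` — YM-DAG nodes N13∕N11 · the live-selector branch KEYED TO NODE 00's LIVE SELECTOR OF RECORD: at every live re-pin
# `θ.liveRepin` (node00-def-K0a, director-ym LINE №114 (α)) — in particular at the re-pinned K0′ witness `θ₀ˡⁱᵛᵉ = theta12LiveOfRecord F N ζ Rz Zt` — the
# 𝐑-leaf of record, the node `Dag.B14_main`, `B16.Thm1Printed` at the datum, and «𝐑 of record = identity a.e.» follow from N11's slot (S1ᵀ) ALONE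
# ([Balaban1988Convergent] p. 244, Thm 1 p. 262; [Balaban1989LargeFieldI] (0.3) p. 176, (i)–(ii) p. 177; [Balaban1989LargeFieldII] Thm 1 p. 355)

statement-level bookkeeping over published theorems with citation tags; kernel-checked compositions of tree theorems;
nothing here is a claim about the Yang–Mills mass gap.

Cell `pub-ymgap` (HUMAN RULING D-0062, Track A), seat `pub-ymgap-dag-n11-e` (R134 fan-out row N11∕s3 «`ThmP245Printed` :375 via `rOperation` from N13's `ROpLeaf`
(pairs with n13-c)»), generation 4 — trigger (t2″) of this seat's HANDOFF: node00-def-K0a's `Node00/Record12LiveSelector.lean` (p477230) and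
`Node00/Record12LiveSelectorTorus.lean` (p478101) LANDED.  [III] = [Balaban1988Convergent], [IV] = [Balaban1989LargeFieldI], [B16] = [Balaban1989LargeFieldII].
BY NAME and UNCHANGED (imported, never restated): this seat's `…B16RLeafRecord12Live` (`rOpLeaf_VOfRecord₁₂_of_idem_of_dead`, `sLaw₁₂_all_of_thmP245_of_idem_of_dead`,
`densitiesDescribed_at_record₁₂_of_idem_of_dead`, `b14_main_at_record₁₂_of_idem_of_dead`, `b14_main_of_isRecordOfRecord₁₂C_datum_of_idem_of_dead`,
`thm1Printed_datumOfRecord₁₂_of_laws_of_idem_of_dead`, `fibreIntegral_rterm_eq_zero_of_not_live`, `densOfRecord₁₂_succ_ae_eq_tdens_of_idem_of_dead` — the leaf and the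
junction for ANY `θ` whose positive-level selectors are idempotent and move only dead sequences); node00-def-K0a's `Node00.Record12LiveSelector` (`LiveSeq`, `liveSelOfSlot`,
`liveSelOfSlot_of_live`, `liveSelOfSlot_of_none`, `liveSeq_liveSelOfSlot`, `ppSelLiveOfRecord`, `ppSelLiveOfRecord_succ`, `ppSelLiveOfRecord_succ_eq`, `Stage12Params.liveRepin`,
`Stage12Params.Admissible.liveRepin`, `theta12LiveOfRecord`, `admissible_theta12OfRecord`, `theta12OfRecord_s2`) and `Node00.Record12LiveSelectorTorus` (`liveSeq_of_ne_zero`: the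
bridge «non-zero slot and non-zero own fibre integral, in ANY instance's currency ⇒ live»).

CONTENTS (0 `sorry`, 0 `def`, standard axioms).
§1 THE TWO SELECTOR CLAUSES OF `…B16RLeafRecord12Live` §2 HOLD AT THE LIVE SELECTOR, BY CONSTRUCTION (generic slot family `f`, then the live selector OF RECORD at
   level `k+1` for generic `E`, `w`): `liveSelOfSlot_idem` (a value of the live selector is live, hence fixed — or no sequence is live and the selector is the
   identity) · `not_liveSeq_of_liveSelOfSlot_ne` (a moved sequence is not live — live ones are fixed) · `dead_of_not_liveSeq` (NOT LIVE ⇒ DEAD: this seat's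
   fibre-constancy lemma `fibreIntegral_rterm_eq_zero_of_not_live` + K0a's bridge `liveSeq_of_ne_zero`) · `dead_of_liveSelOfSlot_ne` · `ppSelLiveOfRecord_succ_idem` ·
   `dead_of_ppSelLiveOfRecord_succ_ne`.
§2 ★ AT EVERY LIVE RE-PIN `θ.liveRepin` (ANY `θ : Stage12Params`; provisos `(θ.liveRepin).Provisos₁₂` — only their `base` reads the selector —, admissibility and
   signs of `θ`, transported by K0a's `rfl` views): `rOpLeaf_VOfRecord₁₂_liveRepin` · `…_of_inInterval` · `sLaw₁₂_all_of_thmP245_liveRepin` (THEOREM 1 [III] at the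
   re-pinned objects of record from (S1ᵀ) ALONE) · `densitiesDescribed_at_record₁₂_liveRepin` · `b14_main_at_record₁₂_liveRepin` (THE NODE, no 𝐑-reading hypothesis) ·
   `b14_main_of_isRecordOfRecord₁₂C_datum_liveRepin` (K1′ `stub_nodes12` binder shape) · `thm1Printed_datumOfRecord₁₂_liveRepin_of_laws` (THE ROUTE's (B)-FACE FIRST
   CONJUNCT from the Theorem of p. 245 along the windowed runs alone) · `densOfRecord₁₂_succ_ae_eq_tdens_liveRepin` (★ `ρ_{k+1} = 𝐓ρ_k` a.e., `k < K`: 𝐑 OF RECORD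
   CHANGES NO DENSITY OF A LIVE-RE-PINNED RUN BEYOND A NULL SET).
§3 AT THE RE-PINNED K0′ WITNESS `θ₀ˡⁱᵛᵉ = theta12LiveOfRecord F N ζ Rz Zt` (for EVERY choice of the residual objects `ζ, Rz, Zt`; admissibility by K0a's
   `admissible_theta12OfRecord`, signs `κ = E₀ = B₀ = 1` by `theta12OfRecord_s2`): `rOpLeaf_VOfRecord₁₂_theta12LiveOfRecord` · `…_of_inInterval` ·
   `b14_main_at_record₁₂_theta12LiveOfRecord` · `b14_main_of_isRecordOfRecord₁₂C_datum_theta12LiveOfRecord` · `thm1Printed_datumOfRecord₁₂_theta12LiveOfRecord_of_laws` ·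
   `densOfRecord₁₂_succ_ae_eq_tdens_theta12LiveOfRecord`.

HONEST FRAMING — READ THIS BEFORE CITING.  Count-neutral kernel bookkeeping; nothing of Bałaban's is asserted: not Theorem 1 [B16], not (1.1)–(1.2) [IV], not the
Theorem of p. 245 ∕ Thms 1–2 [III], no estimate.  Displayed hypotheses: `(θ.liveRepin F N).Provisos₁₂ F N` (K0′-type content at the re-pin — `base.intPiece`∕`rstep`
read the slot families AT THE LIVE SELECTOR and are NOT transported from `θ`), admissibility and the signs `0 ≤ κ, E₀, B₀` of `θ`, the coupling window, and (S1ᵀ) at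
the re-pinned objects (`∀ k < K, SLaw₁₂ (θ.liveRepin) p k → TLaw₁₂ (θ.liveRepin) p k`).  WHAT §2's LAST THEOREM SAYS IN WORDS (located, for the K0′∕K1′ readers and the
planner; not a claim, not a second gap): at a live re-pin the operation 𝐑 OF RECORD IS THE IDENTITY UP TO NULL SETS at every level `k+1 ≤ K` — it integrates out only
terms of zero fibre mass —, so N13's printed content ([B16] Thm 1: the renormalisation of large-field boundary terms WITH mass after `Nmem` steps, [IV] p. 177 (i)–(ii))
is VOID at such a record and Theorem 1's analytic burden there is ALL in N11's (S1ᵀ); and by seat dag-n11-d's reading (pub-ymgap INBOX l.14524) (S1ᵀ) at level 0 is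
expected to FAIL at K0b's residuals of record (uniform `ζ0`), so at `theta12LiveOfRecord F N (zeta316OfRecord …) (RzOfRecord …) (ZtOfRecord …)` §3's `hT` is expected
unsatisfiable — §3 is stated for EVERY `(ζ, Rz, Zt)`, i.e. for the K1′ witness-to-be as much as for the K0′ inhabitant.  N11 and N13 are NOT discharged by this file;
counts unmoved.  One finite four-torus programme at fixed `ε`, Bałaban AS PRINTED with locators; nothing continuum ∕ ℝ⁴ ∕ OS ∕ mass gap ∕ Clay.  No `sorry`, no `def`, no
`instance`, no `notation`.
Sources: T. Bałaban, CMP **119** (1988) 243–285 [III] p. 244, Theorem p. 245, (2.18) p. 257, Thm 1 p. 262, Thm 2 p. 263, (3.22)–(3.25) pp. 269–270; CMP **122** (1989)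
175–202 [IV] (0.2)–(0.4) p. 176, (i)–(ii) p. 177; CMP **122** (1989) 355–392 [B16] Thm 1 p. 355, (1.100)–(1.101) pp. 390–391.

v1.1 (same seat; APPEND-ONLY — every v1.0 declaration byte-identical; one `open` added): §4 ★ (S1ᵀ) IS NEEDED ONLY AT THE LIVE SEQUENCES.  On the dead-moving branch a DEAD
sequence has post-𝐑 slot IDENTICALLY ZERO — pointwise, no proviso (`rstepOfSel_TexpA_eq_zero_of_dead_of_idem`: a dead fixed point carries only ratios with zero
numerator — its own `0∕0 = 0` and the dead sequences carried onto it —, a dead moved sequence is off the range; `slotsOfRecord₁₂_succ_eq_zero_of_dead`,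
`slotsOfRecord_liveRepin_succ_eq_zero_of_not_liveSeq`); hence `SLaw₁₂ (k+1)` follows from the 𝐓-image laws with the §2 dichotomy demanded ONLY AT THE LIVE
(= not dead) SEQUENCES of `𝐓ρ_k` (`sLaw₁₂_succ_of_tLawLive_of_idem_of_dead`; at a live re-pin in K0a's currency `sLaw₁₂_succ_liveRepin_of_tLawLive` — hypothesis
«`LiveSeq … s →` dichotomy at `s`»), and so do Theorem 1 at the re-pinned objects (`sLaw₁₂_all_liveRepin_of_thmP245Live`), its conclusion `densitiesDescribed` and
the node (`b14_main_at_record₁₂_liveRepin_of_lawsLive`) and the (B)-face first conjunct (`inductionStep_datumOfRecord₁₂_liveRepin_of_tLawLive`,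
`thm1Printed_datumOfRecord₁₂_liveRepin_of_lawsLive`; θ₀ˡⁱᵛᵉ: `thm1Printed_datumOfRecord₁₂_theta12LiveOfRecord_of_lawsLive`, `b14_main_…_theta12LiveOfRecord_of_lawsLive`).
LOCATED MEANING (for the K1′ `stub_nodes12` provers and the plan; count-neutral): on the K0′ witness line N11's share of Theorem 1 is the 𝐓-image LAWS at every
sequence plus the §2 IDENTITY of `𝐓ρ_k`'s slot ONLY WHERE THE TERM HAS NON-ZERO FIBRE MASS SOMEWHERE — the junk region of zero-fibre-mass terms (whose
`Classical.choice` transport versions make «slot = 0» unprovable and «slot = e^{…} a.e. on the support» false) is OUT of the obligation, in the spirit of director-ym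
LINE №118's guard.  §5: the sign `0 ≤ g_{k+1}` is FREE (`gOfRecord₁₀_succ_nonneg`: the (0.20) forward solution is `1∕√y` or `0`), so the leaf at θ₀ˡⁱᵛᵉ costs the
provisos alone (`rOpLeaf_VOfRecord₁₂_theta12LiveOfRecord_of_provisos`).  Nothing of Bałaban asserted.
-/

noncomputable section

open MeasureTheory
open scoped BigOperators Matrix.Norms.L2Operator

namespace Literature.MathematicalPhysics.QuantumFieldTheory.Balaban1983to89.B16RLeafRecord12AtLive

open T4Continuum T4DatumAssembly Node00 B14.Eq218Concrete DagBinding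
open B16RLeafRecord11 B14NodeKnitRecord12R B16RLeafRecord12 B16RLeafRecord12Live
open B14NodeKnitTowerDatum (densitiesDescribed_iff_core)

variable (F : T4Family) (N : ℕ) [NeZero N]

/-! ## §1  The two selector clauses hold at the live selector, by construction -/

section LiveSlot

variable {F N} {ν : Stage7Numerics} {τ : TowerNumerics} {p : B12.RunParams} {g : ℕ → ℝ} {k : ℕ}

/-- **THE LIVE SELECTOR IS IDEMPOTENT** (node00-def-K0a's `liveSelOfSlot`): a value of the live selector is live (`liveSeq_liveSelOfSlot`), hence fixed
(`liveSelOfSlot_of_live`); with no live sequence the selector is the identity (`liveSelOfSlot_of_none`).  Print's `Z″″ = Z″`.  (The same three-line fact is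
`Summit.QuantumFields.YangMills.BalabanUVNodes.N12AtRecord12LiveSelector.liveSelOfSlot_idem`, seat dag-n12-d — Summits-side, not importable into `Literature`; restated
here for the Literature-side consumers, cited.) [cite: Balaban1989LargeFieldI, (0.3) p.176, p.177 (i)–(ii) (bookkeeping)] -/
theorem liveSelOfSlot_idem (f : TexpASlot F N ν τ.M p g k) (a : SeqOfRecord F ν τ.M g p.K k) :
    liveSelOfSlot F N ν τ p g k f (liveSelOfSlot F N ν τ p g k f a) = liveSelOfSlot F N ν τ p g k f a := by
  by_cases h : ∃ s', LiveSeq F N ν τ p g k f s'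
  · exact liveSelOfSlot_of_live F N (liveSeq_liveSelOfSlot F N h a)
  · rw [liveSelOfSlot_of_none F N h (liveSelOfSlot F N ν τ p g k f a)]

/-- **A SEQUENCE THE LIVE SELECTOR MOVES IS NOT LIVE** (live sequences are fixed, `liveSelOfSlot_of_live`). [cite: Balaban1989LargeFieldI, (0.3) p.176 (bookkeeping)] -/
theorem not_liveSeq_of_liveSelOfSlot_ne (f : TexpASlot F N ν τ.M p g k) {a : SeqOfRecord F ν τ.M g p.K k}
    (hne : liveSelOfSlot F N ν τ p g k f a ≠ a) : ¬ LiveSeq F N ν τ p g k f a :=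
  fun hs => hne (liveSelOfSlot_of_live F N hs)

/-- **NOT LIVE ⇒ DEAD**, in this seat's currency: if `a` is not live for the slot family `f` (K0a's `LiveSeq`), the restricted integral of its term `χ_k(a)·f(a)` over
its own `Z′(a)`-variables vanishes AT EVERY FIELD — `…B16RLeafRecord12Live.fibreIntegral_rterm_eq_zero_of_not_live` (fibre-constancy) behind K0a's bridge
`liveSeq_of_ne_zero` (any `DecidableEq (PBond …)` instance). [cite: Balaban1989LargeFieldI, (0.3) p.176; Balaban1988Convergent, (2.18) p.257] -/
theorem dead_of_not_liveSeq (f : TexpASlot F N ν τ.M p g k) {a : SeqOfRecord F ν τ.M g p.K k} (hnl : ¬ LiveSeq F N ν τ p g k f a)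
    (V : GaugeField (F.P p.K) k (SU N)) :
    B15.BasicStep.fibreIntegral (fibOfSeq F ν τ p g k a) (rterm (sliceOfRecord F N ν τ.M p g k f) a) V = 0 :=
  fibreIntegral_rterm_eq_zero_of_not_live (sliceOfRecord F N ν τ.M p g k f) (fibOfSeq F ν τ p g k) a
    (fun ⟨_, hf, hI⟩ => hnl (liveSeq_of_ne_zero F N _ hf hI)) V

/-- **A SEQUENCE THE LIVE SELECTOR MOVES IS DEAD.** [cite: Balaban1989LargeFieldI, (0.3) p.176, p.177 (i)–(ii) (bookkeeping)] -/
theorem dead_of_liveSelOfSlot_ne (f : TexpASlot F N ν τ.M p g k) {a : SeqOfRecord F ν τ.M g p.K k}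
    (hne : liveSelOfSlot F N ν τ p g k f a ≠ a) (V : GaugeField (F.P p.K) k (SU N)) :
    B15.BasicStep.fibreIntegral (fibOfSeq F ν τ p g k a) (rterm (sliceOfRecord F N ν τ.M p g k f) a) V = 0 :=
  dead_of_not_liveSeq f (not_liveSeq_of_liveSelOfSlot_ne f hne) V

end LiveSlot

section LiveRecordSel

variable {F N} (ν : Stage7Numerics) (τ : TowerNumerics) (E : B12.RunParams → ℝ) (w : StepWeightsOfRecord F N ν τ.M) (p : B12.RunParams) (g : ℕ → ℝ)

/-- **THE LIVE SELECTOR OF RECORD IS IDEMPOTENT AT EVERY POSITIVE LEVEL** (`ppSelLiveOfRecord_succ` + `liveSelOfSlot_idem`; Summits-side twin: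
`Summit.QuantumFields.YangMills.BalabanUVNodes.N12AtRecord12LiveSelector.ppSelLiveOfRecord_succ_idem`, seat dag-n12-d — not importable here, cited).
[cite: Balaban1989LargeFieldI, (0.3) p.176, p.177 (bookkeeping)] -/
theorem ppSelLiveOfRecord_succ_idem (k : ℕ) (a : SeqOfRecord F ν τ.M g p.K (k + 1)) :
    ppSelLiveOfRecord F N ν τ E w p g (k + 1) (ppSelLiveOfRecord F N ν τ E w p g (k + 1) a) = ppSelLiveOfRecord F N ν τ E w p g (k + 1) a := by
  rw [ppSelLiveOfRecord_succ]
  exact liveSelOfSlot_idem _ a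

/-- **THE LIVE SELECTOR OF RECORD MOVES ONLY DEAD SEQUENCES of def-T's pre-𝐑 family at the same level** (`ppSelLiveOfRecord_succ_eq`: at level `k+1` it IS the live
selector of `slotsTOfRecord … (ppSelLiveOfRecord …) p g (k+1)`; then `dead_of_liveSelOfSlot_ne`). [cite: Balaban1989LargeFieldI, (0.3) p.176, p.177 (i)–(ii); Balaban1988Convergent, (3.24)–(3.25) p.270] -/
theorem dead_of_ppSelLiveOfRecord_succ_ne (k : ℕ) {a : SeqOfRecord F ν τ.M g p.K (k + 1)}
    (hne : ppSelLiveOfRecord F N ν τ E w p g (k + 1) a ≠ a) (V : GaugeField (F.P p.K) (k + 1) (SU N)) :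
    B15.BasicStep.fibreIntegral (fibOfSeq F ν τ p g (k + 1) a)
        (rterm (sliceOfRecord F N ν τ.M p g (k + 1) (slotsTOfRecord F N ν τ E w (ppSelLiveOfRecord F N ν τ E w) p g (k + 1))) a) V = 0 := by
  rw [ppSelLiveOfRecord_succ_eq] at hne
  exact dead_of_liveSelOfSlot_ne _ hne V

end LiveRecordSel

/-! ## §2  ★ At every live re-pin `θ.liveRepin`: the leaf, the junction, and «𝐑 of record = identity a.e.» from (S1ᵀ) alone -/

section Repin

variable (θ : Stage12Params F N) (p : B12.RunParams)

/-- **★ THE 𝐑-LEAF OF RECORD AT A LIVE RE-PIN** (node00-def-K0a's `θ.liveRepin`: `θ`'s selector replaced by the live selector of record, everything else unchanged):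
under the provisos AT THE RE-PIN, admissibility and the displayed signs of `θ`, and `0 ≤ g_{k+1}` (`k < K`), `ROpLeaf (VOfRecord₁₂ F N (θ.liveRepin F N) p)` — this seat's
`rOpLeaf_VOfRecord₁₂_of_idem_of_dead` with BOTH selector clauses discharged by §1.  Scope (header): 𝐑 integrates out only zero-fibre-mass terms here.
[cite: Balaban1988Convergent, p.244, Thm 2 p.263, §2 p.262; Balaban1989LargeFieldI, (0.3) p.176, p.177 (i)–(ii); Balaban1989LargeFieldII, Thm 1 p.355 (not exercised)] -/
theorem rOpLeaf_VOfRecord₁₂_liveRepin (h : (θ.liveRepin F N).Provisos₁₂ F N) (hθ : θ.Admissible F N) (hκ : 0 ≤ θ.s2.lf.κ) (hE₀ : 0 ≤ θ.s2.lf.E₀)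
    (hB₀ : 0 ≤ θ.s2.lf.B₀) (hg : ∀ k, k < p.K → 0 ≤ gOfRecord₁₀ F N θ.toStage9Params p (k + 1)) :
    ROpLeaf (VOfRecord₁₂ F N (θ.liveRepin F N) p) :=
  rOpLeaf_VOfRecord₁₂_of_idem_of_dead F N (θ.liveRepin F N) p h hθ.liveRepin hκ hE₀ hB₀ hg
    (fun k _ a => ppSelLiveOfRecord_succ_idem θ.ν θ.τ9 (EOfRecord₁₀ F N θ.toStage9Params) (wOfRecord₉ F N θ.toStage9Params) p
      (gOfRecord₁₀ F N θ.toStage9Params p) k a)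
    (fun k _ _ hne V => dead_of_ppSelLiveOfRecord_succ_ne θ.ν θ.τ9 (EOfRecord₁₀ F N θ.toStage9Params) (wOfRecord₉ F N θ.toStage9Params) p
      (gOfRecord₁₀ F N θ.toStage9Params p) k hne V)

/-- … with `0 ≤ g_{k+1}` DISCHARGED by the coupling window of the run at the datum of record at the re-pin. [cite: Balaban1989LargeFieldII, Thm 1 p.355; Balaban1987RG1, (0.17)–(0.20) pp.255–256] -/
theorem rOpLeaf_VOfRecord₁₂_liveRepin_of_inInterval (h : (θ.liveRepin F N).Provisos₁₂ F N) (hθ : θ.Admissible F N) (hκ : 0 ≤ θ.s2.lf.κ)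
    (hE₀ : 0 ≤ θ.s2.lf.E₀) (hB₀ : 0 ≤ θ.s2.lf.B₀) {γ : ℝ} (hsc : ((datumOfRecord₁₂ F N (θ.liveRepin F N) h).C p).flow.InInterval γ p.K) :
    ROpLeaf (VOfRecord₁₂ F N (θ.liveRepin F N) p) :=
  rOpLeaf_VOfRecord₁₂_liveRepin F N θ p h hθ hκ hE₀ hB₀
    (fun k hk => by
      have hgk := (hsc (k + 1) hk).1
      rw [flow_g_datumOfRecord₁₂] at hgk
      exact hgk.le)

/-- **★ THEOREM 1 [III] AT THE LIVE-RE-PINNED OBJECTS OF RECORD FROM N11's ONE SLOT (S1ᵀ) ALONE** ([Balaban1988Convergent] Thm 1 p. 262): `∀ k ≤ K, SLaw₁₂ (θ.liveRepin) p k`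
from `hT : ∀ k < K, SLaw₁₂ (θ.liveRepin) p k → TLaw₁₂ (θ.liveRepin) p k` and the displayed signs — N13's 𝐑-half being the theorem `rOpLeaf_VOfRecord₁₂_liveRepin`.
[cite: Balaban1988Convergent, Thm 1 p.262; Theorem p.245; p.244; Balaban1989LargeFieldI, (0.3) p.176, p.177 (i)–(ii)] -/
theorem sLaw₁₂_all_of_thmP245_liveRepin (h : (θ.liveRepin F N).Provisos₁₂ F N) (hθ : θ.Admissible F N) (hκ : 0 ≤ θ.s2.lf.κ) (hE₀ : 0 ≤ θ.s2.lf.E₀)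
    (hB₀ : 0 ≤ θ.s2.lf.B₀) (hg : ∀ k, k < p.K → 0 ≤ gOfRecord₁₀ F N θ.toStage9Params p (k + 1))
    (hT : ∀ k, k < p.K → SLaw₁₂ F N (θ.liveRepin F N) p k → TLaw₁₂ F N (θ.liveRepin F N) p k) :
    ∀ k, k ≤ p.K → SLaw₁₂ F N (θ.liveRepin F N) p k :=
  sLaw₁₂_all_of_rAssumedP244 F N (θ.liveRepin F N) p
    ((rOpLeaf₁₂_iff_rAssumedP244 F N (θ.liveRepin F N) p).1 (rOpLeaf_VOfRecord₁₂_liveRepin F N θ p h hθ hκ hE₀ hB₀ hg)) hT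

variable (w : WorldP) (h : (θ.liveRepin F N).Provisos₁₂ F N)

/-- **Theorem 1's conclusion `densitiesDescribed` AT A WORLD BOUND TO THE LIVE-RE-PINNED DATUM, from (S1ᵀ) alone** (+ signs, non-negative history).
[cite: Balaban1988Convergent, Thm 1 p.262; Theorem p.245; p.244] -/
theorem densitiesDescribed_at_record₁₂_liveRepin (hC : w.C = (datumOfRecord₁₂ F N (θ.liveRepin F N) h).C) (hθ : θ.Admissible F N) (hκ : 0 ≤ θ.s2.lf.κ)
    (hE₀ : 0 ≤ θ.s2.lf.E₀) (hB₀ : 0 ≤ θ.s2.lf.B₀) (hg : ∀ k, k < p.K → 0 ≤ gOfRecord₁₀ F N θ.toStage9Params p (k + 1))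
    (hT : ∀ k, k < p.K → SLaw₁₂ F N (θ.liveRepin F N) p k → TLaw₁₂ F N (θ.liveRepin F N) p k) :
    (leavesP w p).densitiesDescribed :=
  densitiesDescribed_at_record₁₂_of_rOpLeaf F N (θ.liveRepin F N) p w h hC (rOpLeaf_VOfRecord₁₂_liveRepin F N θ p h hθ hκ hE₀ hB₀ hg) hT

/-- **N11 · `Dag.B14_main (leavesP w P)` AT A WORLD BOUND TO A LIVE-RE-PINNED DATUM — ONE DISPLAYED SLOT (S1ᵀ), NO 𝐑-READING HYPOTHESIS, NO SELECTOR CLAUSE**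
(both selector clauses are theorems of the live selector, §1; the sign `0 ≤ g_{k+1}` is read from the node's own interval antecedent; the node's `rOperation`
antecedent is redundant here).  Count-neutral slot landing. [cite: Balaban1988Convergent, Thm 1 p.262; Theorem p.245; p.244; (2.6) p.255] -/
theorem b14_main_at_record₁₂_liveRepin (hC : w.C = (datumOfRecord₁₂ F N (θ.liveRepin F N) h).C) (hθ : θ.Admissible F N) (hκ : 0 ≤ θ.s2.lf.κ)
    (hE₀ : 0 ≤ θ.s2.lf.E₀) (hB₀ : 0 ≤ θ.s2.lf.B₀)
    (hT : (leavesP w p).b7 → (leavesP w p).b8 → (leavesP w p).b9 → (leavesP w p).b10 → (leavesP w p).b11 →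
      (leavesP w p).smallCouplings → (leavesP w p).smallFieldInductive → (leavesP w p).flowControl →
        ∀ k, k < p.K → SLaw₁₂ F N (θ.liveRepin F N) p k → TLaw₁₂ F N (θ.liveRepin F N) p k) :
    Dag.B14_main (leavesP w p) :=
  b14_main_at_record₁₂_of_idem_of_dead F N (θ.liveRepin F N) p w h hC hθ.liveRepin hκ hE₀ hB₀
    (fun k _ a => ppSelLiveOfRecord_succ_idem θ.ν θ.τ9 (EOfRecord₁₀ F N θ.toStage9Params) (wOfRecord₉ F N θ.toStage9Params) p
      (gOfRecord₁₀ F N θ.toStage9Params p) k a)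
    (fun k _ _ hne V => dead_of_ppSelLiveOfRecord_succ_ne θ.ν θ.τ9 (EOfRecord₁₀ F N θ.toStage9Params) (wOfRecord₉ F N θ.toStage9Params) p
      (gOfRecord₁₀ F N θ.toStage9Params p) k hne V) hT

/-- **N11 IN THE BINDER SHAPE OF THE ROUTE's K1′ STUB `stub_nodes12` AT A LIVE-RE-PINNED DATUM** (a world `w` with `IsRecordOfRecord₁₂C F N (datumOfRecord₁₂ F N
(θ.liveRepin F N) h) w`): the N11 conjunct of `DagBinding.Nodes (leavesP w P)` at every run from (S1ᵀ) at the re-pinned objects alone (+ signs).  For a K1′ prover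
whose witness is a live re-pin, N11's share of the stub IS (S1ᵀ) — and nothing else. [cite: Balaban1988Convergent, Thm 1 p.262; Theorem p.245; p.244 (bookkeeping at the record)] -/
theorem b14_main_of_isRecordOfRecord₁₂C_datum_liveRepin (hrec : IsRecordOfRecord₁₂C F N (datumOfRecord₁₂ F N (θ.liveRepin F N) h) w)
    (hθ : θ.Admissible F N) (hκ : 0 ≤ θ.s2.lf.κ) (hE₀ : 0 ≤ θ.s2.lf.E₀) (hB₀ : 0 ≤ θ.s2.lf.B₀)
    (hT : ∀ P : B12.RunParams, (leavesP w P).b7 → (leavesP w P).b8 → (leavesP w P).b9 → (leavesP w P).b10 → (leavesP w P).b11 →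
      (leavesP w P).smallCouplings → (leavesP w P).smallFieldInductive → (leavesP w P).flowControl →
        ∀ k, k < P.K → SLaw₁₂ F N (θ.liveRepin F N) P k → TLaw₁₂ F N (θ.liveRepin F N) P k) (P : B12.RunParams) :
    Dag.B14_main (leavesP w P) :=
  b14_main_at_record₁₂_liveRepin F N θ P w h (construction_eq_of_isRecordOfRecord₁₂C hrec) hθ hκ hE₀ hB₀ (hT P)

/-- **★ THE ROUTE's K1′ (B)-FACE FIRST CONJUNCT `B16.Thm1Printed (datumOfRecord₁₂ F N (θ.liveRepin F N) h).C` FROM THE THEOREM OF p. 245 ALONG THE WINDOWED RUNS ALONE,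
AT A LIVE RE-PIN** ([Balaban1989LargeFieldII] Thm 1 p. 355 = [Balaban1988Convergent] Thm 1 p. 262 over the datum's `Sect2Data`): N11's slot (S1ᵀ) in law currency along
every run whose flow stays in `]0, γ]` (`0 < γ`) gives Theorem 1 at the re-pinned datum — no selector clause, no 𝐑-reading hypothesis.  Nothing of Sects. 1–3 asserted.
[cite: Balaban1989LargeFieldII, Thm 1 p.355; Balaban1988Convergent, Thm 1 p.262; Theorem p.245; p.244] -/
theorem thm1Printed_datumOfRecord₁₂_liveRepin_of_laws (hθ : θ.Admissible F N) (hκ : 0 ≤ θ.s2.lf.κ) (hE₀ : 0 ≤ θ.s2.lf.E₀)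
    (hB₀ : 0 ≤ θ.s2.lf.B₀) {γ : ℝ} (hγ : 0 < γ)
    (hT : ∀ P : B12.RunParams, ((datumOfRecord₁₂ F N (θ.liveRepin F N) h).C P).flow.InInterval γ P.K →
      ∀ k, k < P.K → SLaw₁₂ F N (θ.liveRepin F N) P k → TLaw₁₂ F N (θ.liveRepin F N) P k) :
    B16.Thm1Printed (datumOfRecord₁₂ F N (θ.liveRepin F N) h).C :=
  thm1Printed_datumOfRecord₁₂_of_laws_of_idem_of_dead F N (θ.liveRepin F N) h hθ.liveRepin hκ hE₀ hB₀ hγ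
    (fun P _ k _ a => ppSelLiveOfRecord_succ_idem θ.ν θ.τ9 (EOfRecord₁₀ F N θ.toStage9Params) (wOfRecord₉ F N θ.toStage9Params) P
      (gOfRecord₁₀ F N θ.toStage9Params P) k a)
    (fun P _ k _ _ hne V => dead_of_ppSelLiveOfRecord_succ_ne θ.ν θ.τ9 (EOfRecord₁₀ F N θ.toStage9Params) (wOfRecord₉ F N θ.toStage9Params) P
      (gOfRecord₁₀ F N θ.toStage9Params P) k hne V) hT

/-- **★ `ρ_{k+1} = 𝐓ρ_k` ALMOST EVERYWHERE AT A LIVE RE-PIN, `k < K`**: under the provisos at the re-pin (`base.rstep`: def-R's support-form (0.3) provisos of the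
pre-𝐑 tower), the density of record after the step equals the 𝐓-stepped density a.e. — this seat's `densOfRecord₁₂_succ_ae_eq_tdens_of_idem_of_dead` with both
selector clauses discharged by §1.  IN WORDS: at a live re-pin the operation 𝐑 OF RECORD is the identity up to null sets at every level; N13's printed 𝐑 ([B16]
Thm 1) does nothing there. [cite: Balaban1989LargeFieldI, (0.2)–(0.4) p.176, p.177 (i)–(ii); Balaban1988Convergent, (2.18) p.257, Thm 1 p.262, (3.24)–(3.25) p.270; Balaban1989LargeFieldII, Thm 1 p.355 (not exercised)] -/
theorem densOfRecord₁₂_succ_ae_eq_tdens_liveRepin (hP : (θ.liveRepin F N).Provisos₁₂ F N) (k : ℕ) (hk : k < p.K) :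
    densOfRecord₁₀ F N (θ.liveRepin F N).toStage9Params p (k + 1)
      =ᵐ[fieldMeasure (F.P p.K) (k + 1) (SU N)] tdensOfRecord₁₀ F N (θ.liveRepin F N).toStage9Params p k :=
  densOfRecord₁₂_succ_ae_eq_tdens_of_idem_of_dead F N (θ.liveRepin F N) p hP k hk
    (fun a => ppSelLiveOfRecord_succ_idem θ.ν θ.τ9 (EOfRecord₁₀ F N θ.toStage9Params) (wOfRecord₉ F N θ.toStage9Params) p
      (gOfRecord₁₀ F N θ.toStage9Params p) k a)
    (fun _ hne V => dead_of_ppSelLiveOfRecord_succ_ne θ.ν θ.τ9 (EOfRecord₁₀ F N θ.toStage9Params) (wOfRecord₉ F N θ.toStage9Params) p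
      (gOfRecord₁₀ F N θ.toStage9Params p) k hne V)

end Repin

/-! ## §3  At the re-pinned K0′ witness `θ₀ˡⁱᵛᵉ = theta12LiveOfRecord F N ζ Rz Zt` (every choice of the residual objects) -/

section Theta

variable (ζ : ZetaOfRecord F N numerics7OfRecord₁₂ 1) (Rz : (K : ℕ) → Sect2.Residual (F.P K) (MatA N)) (Zt : (K : ℕ) → TkResidualW F N (FluctV N) K)
variable (p : B12.RunParams)

/-- `θ₀`'s term constants have `κ = 1 ≥ 0` (`theta12OfRecord_s2`, `sect2NumericsOfRecord₁₂`, `lfConstsOfRecord₁₂`). [cite: Balaban1988Convergent, (2.28) p.259 (bookkeeping witness)] -/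
theorem kappa_nonneg_theta12OfRecord : 0 ≤ (theta12OfRecord F N ζ Rz Zt).s2.lf.κ := by
  rw [theta12OfRecord_s2]; norm_num [sect2NumericsOfRecord₁₂, lfConstsOfRecord₁₂]

/-- `θ₀`'s term constants have `E₀ = 1 ≥ 0`. [cite: Balaban1988Convergent, (2.31) p.260 (bookkeeping witness)] -/
theorem E0_nonneg_theta12OfRecord : 0 ≤ (theta12OfRecord F N ζ Rz Zt).s2.lf.E₀ := by
  rw [theta12OfRecord_s2]; norm_num [sect2NumericsOfRecord₁₂, lfConstsOfRecord₁₂]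

/-- `θ₀`'s term constants have `B₀ = 1 ≥ 0`. [cite: Balaban1988Convergent, (2.42) p.261 (bookkeeping witness)] -/
theorem B0_nonneg_theta12OfRecord : 0 ≤ (theta12OfRecord F N ζ Rz Zt).s2.lf.B₀ := by
  rw [theta12OfRecord_s2]; norm_num [sect2NumericsOfRecord₁₂, lfConstsOfRecord₁₂]

/-- **★ THE 𝐑-LEAF OF RECORD AT THE RE-PINNED K0′ WITNESS `θ₀ˡⁱᵛᵉ`** (director-ym LINE №114 (α); `theta12LiveOfRecord F N ζ Rz Zt = (theta12OfRecord F N ζ Rz Zt).liveRepin`,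
`rfl`): under the provisos at `θ₀ˡⁱᵛᵉ` and `0 ≤ g_{k+1}` (`k < K`) — admissibility and signs are theorems of the numerics of record — `ROpLeaf (VOfRecord₁₂ F N θ₀ˡⁱᵛᵉ p)`.
[cite: Balaban1988Convergent, p.244, Thm 2 p.263; Balaban1989LargeFieldI, (0.3) p.176, p.177 (i)–(ii); Balaban1989LargeFieldII, Thm 1 p.355 (not exercised)] -/
theorem rOpLeaf_VOfRecord₁₂_theta12LiveOfRecord (h : (theta12LiveOfRecord F N ζ Rz Zt).Provisos₁₂ F N)
    (hg : ∀ k, k < p.K → 0 ≤ gOfRecord₁₀ F N (theta12OfRecord F N ζ Rz Zt).toStage9Params p (k + 1)) :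
    ROpLeaf (VOfRecord₁₂ F N (theta12LiveOfRecord F N ζ Rz Zt) p) :=
  rOpLeaf_VOfRecord₁₂_liveRepin F N (theta12OfRecord F N ζ Rz Zt) p h (admissible_theta12OfRecord F N ζ Rz Zt)
    (kappa_nonneg_theta12OfRecord F N ζ Rz Zt) (E0_nonneg_theta12OfRecord F N ζ Rz Zt) (B0_nonneg_theta12OfRecord F N ζ Rz Zt) hg

/-- … with `0 ≤ g_{k+1}` DISCHARGED by the coupling window of the run at the datum of record at `θ₀ˡⁱᵛᵉ`. [cite: Balaban1989LargeFieldII, Thm 1 p.355; Balaban1987RG1, (0.17)–(0.20) pp.255–256] -/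
theorem rOpLeaf_VOfRecord₁₂_theta12LiveOfRecord_of_inInterval (h : (theta12LiveOfRecord F N ζ Rz Zt).Provisos₁₂ F N) {γ : ℝ}
    (hsc : ((datumOfRecord₁₂ F N (theta12LiveOfRecord F N ζ Rz Zt) h).C p).flow.InInterval γ p.K) :
    ROpLeaf (VOfRecord₁₂ F N (theta12LiveOfRecord F N ζ Rz Zt) p) :=
  rOpLeaf_VOfRecord₁₂_liveRepin_of_inInterval F N (theta12OfRecord F N ζ Rz Zt) p h (admissible_theta12OfRecord F N ζ Rz Zt)
    (kappa_nonneg_theta12OfRecord F N ζ Rz Zt) (E0_nonneg_theta12OfRecord F N ζ Rz Zt) (B0_nonneg_theta12OfRecord F N ζ Rz Zt) hsc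

variable (w : WorldP) (h : (theta12LiveOfRecord F N ζ Rz Zt).Provisos₁₂ F N)

/-- **N11 · `Dag.B14_main (leavesP w P)` AT A WORLD BOUND TO THE DATUM OF `θ₀ˡⁱᵛᵉ` — ONE DISPLAYED SLOT (S1ᵀ), nothing else** (admissibility, signs and both selector
clauses are theorems at `θ₀ˡⁱᵛᵉ`). [cite: Balaban1988Convergent, Thm 1 p.262; Theorem p.245; p.244; (2.6) p.255] -/
theorem b14_main_at_record₁₂_theta12LiveOfRecord (hC : w.C = (datumOfRecord₁₂ F N (theta12LiveOfRecord F N ζ Rz Zt) h).C)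
    (hT : (leavesP w p).b7 → (leavesP w p).b8 → (leavesP w p).b9 → (leavesP w p).b10 → (leavesP w p).b11 →
      (leavesP w p).smallCouplings → (leavesP w p).smallFieldInductive → (leavesP w p).flowControl →
        ∀ k, k < p.K → SLaw₁₂ F N (theta12LiveOfRecord F N ζ Rz Zt) p k → TLaw₁₂ F N (theta12LiveOfRecord F N ζ Rz Zt) p k) :
    Dag.B14_main (leavesP w p) :=
  b14_main_at_record₁₂_liveRepin F N (theta12OfRecord F N ζ Rz Zt) p w h hC (admissible_theta12OfRecord F N ζ Rz Zt)
    (kappa_nonneg_theta12OfRecord F N ζ Rz Zt) (E0_nonneg_theta12OfRecord F N ζ Rz Zt) (B0_nonneg_theta12OfRecord F N ζ Rz Zt) hT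

/-- **N11 IN THE K1′ `stub_nodes12` BINDER SHAPE AT THE DATUM OF `θ₀ˡⁱᵛᵉ`** (a world with `IsRecordOfRecord₁₂C F N (datumOfRecord₁₂ F N θ₀ˡⁱᵛᵉ h) w`): the N11 conjunct at
every run from (S1ᵀ) at `θ₀ˡⁱᵛᵉ`'s objects of record ALONE. [cite: Balaban1988Convergent, Thm 1 p.262; Theorem p.245; p.244 (bookkeeping at the record)] -/
theorem b14_main_of_isRecordOfRecord₁₂C_datum_theta12LiveOfRecord
    (hrec : IsRecordOfRecord₁₂C F N (datumOfRecord₁₂ F N (theta12LiveOfRecord F N ζ Rz Zt) h) w)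
    (hT : ∀ P : B12.RunParams, (leavesP w P).b7 → (leavesP w P).b8 → (leavesP w P).b9 → (leavesP w P).b10 → (leavesP w P).b11 →
      (leavesP w P).smallCouplings → (leavesP w P).smallFieldInductive → (leavesP w P).flowControl →
        ∀ k, k < P.K → SLaw₁₂ F N (theta12LiveOfRecord F N ζ Rz Zt) P k → TLaw₁₂ F N (theta12LiveOfRecord F N ζ Rz Zt) P k)
    (P : B12.RunParams) : Dag.B14_main (leavesP w P) :=
  b14_main_of_isRecordOfRecord₁₂C_datum_liveRepin F N (theta12OfRecord F N ζ Rz Zt) w h hrec (admissible_theta12OfRecord F N ζ Rz Zt)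
    (kappa_nonneg_theta12OfRecord F N ζ Rz Zt) (E0_nonneg_theta12OfRecord F N ζ Rz Zt) (B0_nonneg_theta12OfRecord F N ζ Rz Zt) hT P

/-- **★ THE ROUTE's K1′ (B)-FACE FIRST CONJUNCT `B16.Thm1Printed (datumOfRecord₁₂ F N θ₀ˡⁱᵛᵉ h).C` FROM THE THEOREM OF p. 245 ALONG THE WINDOWED RUNS ALONE** (`0 < γ`):
N11's slot (S1ᵀ) in law currency at `θ₀ˡⁱᵛᵉ`'s objects of record ⊢ Theorem 1 at the datum of `θ₀ˡⁱᵛᵉ` — no other hypothesis. [cite: Balaban1989LargeFieldII, Thm 1 p.355; Balaban1988Convergent, Thm 1 p.262; Theorem p.245; p.244] -/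
theorem thm1Printed_datumOfRecord₁₂_theta12LiveOfRecord_of_laws {γ : ℝ} (hγ : 0 < γ)
    (hT : ∀ P : B12.RunParams, ((datumOfRecord₁₂ F N (theta12LiveOfRecord F N ζ Rz Zt) h).C P).flow.InInterval γ P.K →
      ∀ k, k < P.K → SLaw₁₂ F N (theta12LiveOfRecord F N ζ Rz Zt) P k → TLaw₁₂ F N (theta12LiveOfRecord F N ζ Rz Zt) P k) :
    B16.Thm1Printed (datumOfRecord₁₂ F N (theta12LiveOfRecord F N ζ Rz Zt) h).C :=
  thm1Printed_datumOfRecord₁₂_liveRepin_of_laws F N (theta12OfRecord F N ζ Rz Zt) h (admissible_theta12OfRecord F N ζ Rz Zt)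
    (kappa_nonneg_theta12OfRecord F N ζ Rz Zt) (E0_nonneg_theta12OfRecord F N ζ Rz Zt) (B0_nonneg_theta12OfRecord F N ζ Rz Zt) hγ hT

/-- **★ `ρ_{k+1} = 𝐓ρ_k` ALMOST EVERYWHERE AT `θ₀ˡⁱᵛᵉ`, `k < K`** — at the re-pinned K0′ witness the operation 𝐑 of record is the identity up to null sets at every level
(under the provisos at `θ₀ˡⁱᵛᵉ`). [cite: Balaban1989LargeFieldI, (0.2)–(0.4) p.176, p.177 (i)–(ii); Balaban1988Convergent, Thm 1 p.262, (3.24)–(3.25) p.270; Balaban1989LargeFieldII, Thm 1 p.355 (not exercised)] -/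
theorem densOfRecord₁₂_succ_ae_eq_tdens_theta12LiveOfRecord (hP : (theta12LiveOfRecord F N ζ Rz Zt).Provisos₁₂ F N) (k : ℕ) (hk : k < p.K) :
    densOfRecord₁₀ F N (theta12LiveOfRecord F N ζ Rz Zt).toStage9Params p (k + 1)
      =ᵐ[fieldMeasure (F.P p.K) (k + 1) (SU N)] tdensOfRecord₁₀ F N (theta12LiveOfRecord F N ζ Rz Zt).toStage9Params p k :=
  densOfRecord₁₂_succ_ae_eq_tdens_liveRepin F N (theta12OfRecord F N ζ Rz Zt) p hP k hk

end Theta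

/-! ## §4  (v1.1) ★ (S1ᵀ) IS NEEDED ONLY AT THE LIVE SEQUENCES: a dead sequence has post-𝐑 slot identically zero; the leaf, Theorem 1, the node and the (B)-face from the
𝐓-image laws with the §2 dichotomy AT THE LIVE SEQUENCES ONLY -/

section DeadSlots

variable {F N} {P : Params} {G : Type*} [GaugeGroup G] [MeasurableSpace G] [HaarData G] {j : ℕ}

open Classical in
/-- **ON THE DEAD-MOVING BRANCH A DEAD SEQUENCE HAS 𝐑-STEPPED SLOT IDENTICALLY ZERO** (generic over def-R's `rstepOfSel`; pointwise, NO proviso): at a dead FIXED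
point `s` every summand of the 𝐑-factor has a zero numerator — its own ratio is `∫⌈_{Z′(s)} t_s ∕ ∫⌈_{Z′(s)} t_s = 0 ∕ 0 = 0`, every other sequence selected onto `s` is
moved, hence dead (`rratio_eq_zero_of_dead`) —; a dead MOVED sequence is off the range of the idempotent selector (`not_mem_range_of_idem_of_ne`,
`rstepOfSel_TexpA_of_not_mem_range`). [cite: Balaban1989LargeFieldI, (0.3) p.176, p.177 (i)–(ii)] -/
theorem rstepOfSel_TexpA_eq_zero_of_dead_of_idem {hP : DecidableEq (PBond P j)} (r : Step.Repr218 P G j) (sel : r.Adm → r.Adm)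
    (fib : r.Adm → Finset (PBond P j)) (hidem : ∀ a, sel (sel a) = sel a)
    (hdead : ∀ a, sel a ≠ a → ∀ V, B15.BasicStep.fibreIntegral (fib a) (rterm r a) V = 0) (s : r.Adm)
    (hs : ∀ V, B15.BasicStep.fibreIntegral (fib s) (rterm r s) V = 0) (V : GaugeField P j G) :
    (rstepOfSel r sel fib).TexpA s V = 0 := by
  by_cases hfix : sel s = s
  · rw [rstepOfSel_TexpA]
    refine mul_eq_zero_of_right _ (Finset.sum_eq_zero fun a ha => ?_)
    have hsel : sel a = s := (Finset.mem_filter.1 ha).2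
    by_cases has : a = s
    · subst has
      rw [rratio, hs V, zero_div]
    · exact rratio_eq_zero_of_dead r fib a (hdead a fun h => has (h.symm.trans hsel)) s V
  · exact rstepOfSel_TexpA_of_not_mem_range r sel fib s (not_mem_range_of_idem_of_ne hidem hfix) V

end DeadSlots

section DeadSlotsRecord

variable (θ : Stage12Params F N) (p : B12.RunParams)

/-- **AT THE STAGE-12 RECORD, ON THE DEAD-MOVING BRANCH, A DEAD SEQUENCE IS ABSENT FROM `ρ_{k+1}`**: its post-𝐑 slot is the zero function (`slotsOfRecord_succ` +
`rstepOfSel_TexpA_eq_zero_of_dead_of_idem`; the dead clauses stated with the caller's `DecidableEq (PBond …)` instance, bridged by subsingleton-`convert`).  So the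
zero disjunct of the (S)-pin HOLDS at every dead sequence WITHOUT any 𝐓-law input. [cite: Balaban1989LargeFieldI, (0.3) p.176, p.177 (i)–(ii); Balaban1988Convergent, (2.17)–(2.18) p.257, (3.24)–(3.25) p.270] -/
theorem slotsOfRecord₁₂_succ_eq_zero_of_dead (k : ℕ)
    (hidem : ∀ a, θ.ppSel p (gOfRecord₁₀ F N θ.toStage9Params p) (k + 1) (θ.ppSel p (gOfRecord₁₀ F N θ.toStage9Params p) (k + 1) a)
      = θ.ppSel p (gOfRecord₁₀ F N θ.toStage9Params p) (k + 1) a)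
    (hdead : ∀ a, θ.ppSel p (gOfRecord₁₀ F N θ.toStage9Params p) (k + 1) a ≠ a →
      ∀ V, B15.BasicStep.fibreIntegral (fibOfSeq F θ.ν θ.τ9 p (gOfRecord₁₀ F N θ.toStage9Params p) (k + 1) a)
        (rterm (sliceOfRecord F N θ.ν θ.τ9.M p (gOfRecord₁₀ F N θ.toStage9Params p) (k + 1)
          (slotsTOfRecord F N θ.ν θ.τ9 (EOfRecord₁₀ F N θ.toStage9Params) (wOfRecord₉ F N θ.toStage9Params) θ.ppSel p
            (gOfRecord₁₀ F N θ.toStage9Params p) (k + 1))) a) V = 0)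
    (s : SeqOfRecord F θ.ν θ.τ9.M (gOfRecord₁₀ F N θ.toStage9Params p) p.K (k + 1))
    (hs : ∀ V, B15.BasicStep.fibreIntegral (fibOfSeq F θ.ν θ.τ9 p (gOfRecord₁₀ F N θ.toStage9Params p) (k + 1) s)
        (rterm (sliceOfRecord F N θ.ν θ.τ9.M p (gOfRecord₁₀ F N θ.toStage9Params p) (k + 1)
          (slotsTOfRecord F N θ.ν θ.τ9 (EOfRecord₁₀ F N θ.toStage9Params) (wOfRecord₉ F N θ.toStage9Params) θ.ppSel p
            (gOfRecord₁₀ F N θ.toStage9Params p) (k + 1))) s) V = 0) :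
    slotsOfRecord F N θ.ν θ.τ9 (EOfRecord₁₀ F N θ.toStage9Params) (wOfRecord₉ F N θ.toStage9Params) θ.ppSel p
        (gOfRecord₁₀ F N θ.toStage9Params p) (k + 1) s = 0 := by
  funext V
  rw [slotsOfRecord_succ, Pi.zero_apply]
  unfold rstepSlotOfRecord rstepSlot
  refine rstepOfSel_TexpA_eq_zero_of_dead_of_idem
    (sliceOfRecord F N θ.ν θ.τ9.M p (gOfRecord₁₀ F N θ.toStage9Params p) (k + 1)
      (slotsTOfRecord F N θ.ν θ.τ9 (EOfRecord₁₀ F N θ.toStage9Params) (wOfRecord₉ F N θ.toStage9Params) θ.ppSel p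
            (gOfRecord₁₀ F N θ.toStage9Params p) (k + 1)))
    (θ.ppSel p (gOfRecord₁₀ F N θ.toStage9Params p) (k + 1)) (fibOfSeq F θ.ν θ.τ9 p (gOfRecord₁₀ F N θ.toStage9Params p) (k + 1)) hidem ?_ s ?_ V
  · intro a hne W
    have H := hdead a hne W
    convert H using 2
  · intro W
    have H := hs W
    convert H using 2

/-- **★ `TLaw` AT THE LIVE SEQUENCES ONLY ⇒ `SLaw₁₂ (k+1)`, dead-moving branch** (generic θ): if the 𝐓-image slots of `𝐓ρ_k` are re-presented by universal-𝐄 term values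
obeying `Sect2.LawsT … k` AT EVERY SEQUENCE and satisfying the §2 dichotomy («absent, or the §2 identity a.e. on the `χ_{k+1}`-support») ONLY AT THE SEQUENCES WITH
NON-ZERO FIBRE MASS SOMEWHERE (the live ones), then `ρ_{k+1}` has the repaired §2 form: dead sequences are absent from `ρ_{k+1}` (`slotsOfRecord₁₂_succ_eq_zero_of_dead`), a
live sequence is a fixed point (it is not moved: moved ones are dead) where the post-𝐑 slot IS the pre-𝐑 slot on the support (v1.0 `slotsOfRecord₁₂_succ_eq_slotsT_of_fix_of_dead`),
and the laws pass to `k+1` by p. 262 (`LawsT.toRT_succ` under the displayed signs).  `TLaw₁₂ θ p k` implies the hypothesis (drop the guard).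
[cite: Balaban1988Convergent, §2 p.262, Thm 2 p.263, (3.24)–(3.25) p.270; Balaban1989LargeFieldI, (0.3) p.176, p.177 (i)–(ii)] -/
theorem sLaw₁₂_succ_of_tLawLive_of_idem_of_dead (h : θ.Provisos₁₂ F N) (hθ : θ.Admissible F N) (hκ : 0 ≤ θ.s2.lf.κ) (hE₀ : 0 ≤ θ.s2.lf.E₀)
    (hB₀ : 0 ≤ θ.s2.lf.B₀) (k : ℕ) (hk : k < p.K) (hg : 0 ≤ gOfRecord₁₀ F N θ.toStage9Params p (k + 1))
    (hidem : ∀ a, θ.ppSel p (gOfRecord₁₀ F N θ.toStage9Params p) (k + 1) (θ.ppSel p (gOfRecord₁₀ F N θ.toStage9Params p) (k + 1) a)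
      = θ.ppSel p (gOfRecord₁₀ F N θ.toStage9Params p) (k + 1) a)
    (hdead : ∀ a, θ.ppSel p (gOfRecord₁₀ F N θ.toStage9Params p) (k + 1) a ≠ a →
      ∀ V, B15.BasicStep.fibreIntegral (fibOfSeq F θ.ν θ.τ9 p (gOfRecord₁₀ F N θ.toStage9Params p) (k + 1) a)
        (rterm (sliceOfRecord F N θ.ν θ.τ9.M p (gOfRecord₁₀ F N θ.toStage9Params p) (k + 1)
          (slotsTOfRecord F N θ.ν θ.τ9 (EOfRecord₁₀ F N θ.toStage9Params) (wOfRecord₉ F N θ.toStage9Params) θ.ppSel p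
            (gOfRecord₁₀ F N θ.toStage9Params p) (k + 1))) a) V = 0)
    (hT : ∃ (t : SeqOfRecord F θ.ν θ.τ9.M (gOfRecord₁₀ F N θ.toStage9Params p) p.K (k + 1) → Sect2.TermValues (F.P p.K) (MatA N) (FluctV N) θ.τ9.M)
      (Ek : SeqOfRecord F θ.ν θ.τ9.M (gOfRecord₁₀ F N θ.toStage9Params p) p.K (k + 1) → ℝ), Sect2.UniversalE t ∧
      ∀ s, Sect2.LawsT (sect2TowerOfRecord F N (FluctV N) p.K (settingOfRecord₁₂ F N θ p) (θ.Rz p.K) s (t s)) (settingOfRecord₁₂ F N θ p).lf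
          (settingOfRecord₁₂ F N θ p).βc k ∧
        ((∃ V, B15.BasicStep.fibreIntegral (fibOfSeq F θ.ν θ.τ9 p (gOfRecord₁₀ F N θ.toStage9Params p) (k + 1) s)
        (rterm (sliceOfRecord F N θ.ν θ.τ9.M p (gOfRecord₁₀ F N θ.toStage9Params p) (k + 1)
          (slotsTOfRecord F N θ.ν θ.τ9 (EOfRecord₁₀ F N θ.toStage9Params) (wOfRecord₉ F N θ.toStage9Params) θ.ppSel p
            (gOfRecord₁₀ F N θ.toStage9Params p) (k + 1))) s) V ≠ 0) →
          (slotsTOfRecord F N θ.ν θ.τ9 (EOfRecord₁₀ F N θ.toStage9Params) (wOfRecord₉ F N θ.toStage9Params) θ.ppSel p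
            (gOfRecord₁₀ F N θ.toStage9Params p) (k + 1) s = 0 ∨
            ∀ᵐ V ∂(fieldMeasure (F.P p.K) (k + 1) (SU N)), chiSeqOfRecord F N θ.ν θ.τ9.M (gOfRecord₁₀ F N θ.toStage9Params p) p.K (k + 1) s V ≠ 0 →
              slotsTOfRecord F N θ.ν θ.τ9 (EOfRecord₁₀ F N θ.toStage9Params) (wOfRecord₉ F N θ.toStage9Params) θ.ppSel p
            (gOfRecord₁₀ F N θ.toStage9Params p) (k + 1) s V
                = sect2Slot F N (FluctV N) p.K (settingOfRecord₁₂ F N θ p) (θ.Rz p.K) (WtOfRecord₁₂ F N θ p) s (t s) (Ek s)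
                    (UbgOfRecord₁₂ F N θ p (k + 1) s) V))) :
    SLaw₁₂ F N θ p (k + 1) := by
  rw [sLaw₁₂_iff]
  obtain ⟨t, Ek, hu, hs⟩ := hT
  refine ⟨t, Ek, hu, fun s => ⟨(hs s).1.toRT_succ hθ.pos.2.1 hκ hE₀ hB₀ hg, ?_⟩⟩
  by_cases hsd : ∀ V, B15.BasicStep.fibreIntegral (fibOfSeq F θ.ν θ.τ9 p (gOfRecord₁₀ F N θ.toStage9Params p) (k + 1) s)
        (rterm (sliceOfRecord F N θ.ν θ.τ9.M p (gOfRecord₁₀ F N θ.toStage9Params p) (k + 1)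
          (slotsTOfRecord F N θ.ν θ.τ9 (EOfRecord₁₀ F N θ.toStage9Params) (wOfRecord₉ F N θ.toStage9Params) θ.ppSel p
            (gOfRecord₁₀ F N θ.toStage9Params p) (k + 1))) s) V = 0
  · exact Or.inl (slotsOfRecord₁₂_succ_eq_zero_of_dead F N θ p k hidem hdead s hsd)
  · have hlive : ∃ V, B15.BasicStep.fibreIntegral (fibOfSeq F θ.ν θ.τ9 p (gOfRecord₁₀ F N θ.toStage9Params p) (k + 1) s)
        (rterm (sliceOfRecord F N θ.ν θ.τ9.M p (gOfRecord₁₀ F N θ.toStage9Params p) (k + 1)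
          (slotsTOfRecord F N θ.ν θ.τ9 (EOfRecord₁₀ F N θ.toStage9Params) (wOfRecord₉ F N θ.toStage9Params) θ.ppSel p
            (gOfRecord₁₀ F N θ.toStage9Params p) (k + 1))) s) V ≠ 0 := by
      by_contra hnone
      exact hsd fun V => by_contra fun hV => hnone ⟨V, hV⟩
    have hfix : θ.ppSel p (gOfRecord₁₀ F N θ.toStage9Params p) (k + 1) s = s := by
      by_contra hne
      exact hsd (hdead s hne)
    rcases (hs s).2 hlive with h0 | hid
    · exact Or.inl (slotsOfRecord₁₂_succ_eq_zero_of_slotsT_eq_zero F N θ p k s h0)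
    · refine Or.inr ?_
      filter_upwards [hid] with V hV hχ
      rw [slotsOfRecord₁₂_succ_eq_slotsT_of_fix_of_dead F N θ p h k hk s hfix
        (fun a ha hne => hdead a fun heq => hne (heq.symm.trans ha)) V hχ]
      exact hV hχ

end DeadSlotsRecord

section LiveOnlyRepin

variable (θ : Stage12Params F N) (p : B12.RunParams)

/-- **AT A LIVE RE-PIN, A NON-LIVE SEQUENCE IS ABSENT FROM `ρ_{k+1}`** (K0a's currency): `¬ LiveSeq … (slotT_{k+1}) s ⇒ slot_{k+1}(s) = 0` — the zero disjunct of the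
(S)-pin at every non-live sequence of the re-pinned run, without any 𝐓-law input. [cite: Balaban1989LargeFieldI, (0.3) p.176, p.177 (i)–(ii); Balaban1988Convergent, (2.17)–(2.18) p.257] -/
theorem slotsOfRecord_liveRepin_succ_eq_zero_of_not_liveSeq (k : ℕ)
    (s : SeqOfRecord F θ.ν θ.τ9.M (gOfRecord₁₀ F N θ.toStage9Params p) p.K (k + 1))
    (hs : ¬ LiveSeq F N θ.ν θ.τ9 p (gOfRecord₁₀ F N θ.toStage9Params p) (k + 1)
      (slotsTOfRecord F N θ.ν θ.τ9 (EOfRecord₁₀ F N θ.toStage9Params) (wOfRecord₉ F N θ.toStage9Params) (θ.liveRepin F N).ppSel p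
        (gOfRecord₁₀ F N θ.toStage9Params p) (k + 1)) s) :
    slotsOfRecord F N θ.ν θ.τ9 (EOfRecord₁₀ F N θ.toStage9Params) (wOfRecord₉ F N θ.toStage9Params) (θ.liveRepin F N).ppSel p
        (gOfRecord₁₀ F N θ.toStage9Params p) (k + 1) s = 0 :=
  slotsOfRecord₁₂_succ_eq_zero_of_dead F N (θ.liveRepin F N) p k
    (fun a => ppSelLiveOfRecord_succ_idem θ.ν θ.τ9 (EOfRecord₁₀ F N θ.toStage9Params) (wOfRecord₉ F N θ.toStage9Params) p
      (gOfRecord₁₀ F N θ.toStage9Params p) k a)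
    (fun _ hne V => dead_of_ppSelLiveOfRecord_succ_ne θ.ν θ.τ9 (EOfRecord₁₀ F N θ.toStage9Params) (wOfRecord₉ F N θ.toStage9Params) p
      (gOfRecord₁₀ F N θ.toStage9Params p) k hne V)
    s (dead_of_not_liveSeq _ hs)

/-- **★ AT A LIVE RE-PIN: `TLaw` AT THE LIVE SEQUENCES ONLY ⇒ `SLaw₁₂ (k+1)`** (K0a's currency: the §2 dichotomy of `𝐓ρ_k`'s slots is demanded only where `LiveSeq` holds;
the laws `Sect2.LawsT … k` at every sequence; signs displayed; provisos at the re-pin).  This is exactly N11's per-level share of Theorem 1 on the witness line.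
[cite: Balaban1988Convergent, §2 p.262, Thm 2 p.263, (3.24)–(3.25) p.270; Balaban1989LargeFieldI, (0.3) p.176, p.177 (i)–(ii)] -/
theorem sLaw₁₂_succ_liveRepin_of_tLawLive (h : (θ.liveRepin F N).Provisos₁₂ F N) (hθ : θ.Admissible F N) (hκ : 0 ≤ θ.s2.lf.κ)
    (hE₀ : 0 ≤ θ.s2.lf.E₀) (hB₀ : 0 ≤ θ.s2.lf.B₀) (k : ℕ) (hk : k < p.K) (hg : 0 ≤ gOfRecord₁₀ F N θ.toStage9Params p (k + 1))
    (hT : ∃ (t : SeqOfRecord F θ.ν θ.τ9.M (gOfRecord₁₀ F N θ.toStage9Params p) p.K (k + 1) → Sect2.TermValues (F.P p.K) (MatA N) (FluctV N) θ.τ9.M)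
      (Ek : SeqOfRecord F θ.ν θ.τ9.M (gOfRecord₁₀ F N θ.toStage9Params p) p.K (k + 1) → ℝ), Sect2.UniversalE t ∧
      ∀ s, Sect2.LawsT (sect2TowerOfRecord F N (FluctV N) p.K (settingOfRecord₁₂ F N (θ.liveRepin F N) p) (θ.Rz p.K) s (t s))
          (settingOfRecord₁₂ F N (θ.liveRepin F N) p).lf (settingOfRecord₁₂ F N (θ.liveRepin F N) p).βc k ∧
        (LiveSeq F N θ.ν θ.τ9 p (gOfRecord₁₀ F N θ.toStage9Params p) (k + 1)
            (slotsTOfRecord F N θ.ν θ.τ9 (EOfRecord₁₀ F N θ.toStage9Params) (wOfRecord₉ F N θ.toStage9Params) (θ.liveRepin F N).ppSel p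
              (gOfRecord₁₀ F N θ.toStage9Params p) (k + 1)) s →
          (slotsTOfRecord F N θ.ν θ.τ9 (EOfRecord₁₀ F N θ.toStage9Params) (wOfRecord₉ F N θ.toStage9Params) (θ.liveRepin F N).ppSel p
              (gOfRecord₁₀ F N θ.toStage9Params p) (k + 1) s = 0 ∨
            ∀ᵐ V ∂(fieldMeasure (F.P p.K) (k + 1) (SU N)),
              chiSeqOfRecord F N θ.ν θ.τ9.M (gOfRecord₁₀ F N θ.toStage9Params p) p.K (k + 1) s V ≠ 0 →
              slotsTOfRecord F N θ.ν θ.τ9 (EOfRecord₁₀ F N θ.toStage9Params) (wOfRecord₉ F N θ.toStage9Params) (θ.liveRepin F N).ppSel p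
                  (gOfRecord₁₀ F N θ.toStage9Params p) (k + 1) s V
                = sect2Slot F N (FluctV N) p.K (settingOfRecord₁₂ F N (θ.liveRepin F N) p) (θ.Rz p.K) (WtOfRecord₁₂ F N (θ.liveRepin F N) p) s (t s) (Ek s)
                    (UbgOfRecord₁₂ F N (θ.liveRepin F N) p (k + 1) s) V))) :
    SLaw₁₂ F N (θ.liveRepin F N) p (k + 1) := by
  obtain ⟨t, Ek, hu, hs⟩ := hT
  refine sLaw₁₂_succ_of_tLawLive_of_idem_of_dead F N (θ.liveRepin F N) p h hθ.liveRepin hκ hE₀ hB₀ k hk hg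
    (fun a => ppSelLiveOfRecord_succ_idem θ.ν θ.τ9 (EOfRecord₁₀ F N θ.toStage9Params) (wOfRecord₉ F N θ.toStage9Params) p
      (gOfRecord₁₀ F N θ.toStage9Params p) k a)
    (fun _ hne V => dead_of_ppSelLiveOfRecord_succ_ne θ.ν θ.τ9 (EOfRecord₁₀ F N θ.toStage9Params) (wOfRecord₉ F N θ.toStage9Params) p
      (gOfRecord₁₀ F N θ.toStage9Params p) k hne V)
    ⟨t, Ek, hu, fun s => ⟨(hs s).1, fun ⟨V, hV⟩ => (hs s).2 ?_⟩⟩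
  obtain ⟨W, hf, hI⟩ := exists_live_of_fibreIntegral_rterm_ne_zero
    (sliceOfRecord F N θ.ν θ.τ9.M p (gOfRecord₁₀ F N θ.toStage9Params p) (k + 1)
      (slotsTOfRecord F N θ.ν θ.τ9 (EOfRecord₁₀ F N θ.toStage9Params) (wOfRecord₉ F N θ.toStage9Params) (θ.liveRepin F N).ppSel p
        (gOfRecord₁₀ F N θ.toStage9Params p) (k + 1)))
    (fibOfSeq F θ.ν θ.τ9 p (gOfRecord₁₀ F N θ.toStage9Params p) (k + 1)) s V hV
  exact liveSeq_of_ne_zero F N _ hf hI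

/-- **★ THEOREM 1 [III] AT THE LIVE-RE-PINNED OBJECTS OF RECORD FROM (S1ᵀ) AT THE LIVE SEQUENCES ONLY**: from «`SLaw₁₂ (θ.liveRepin) p k ⇒` the 𝐓-image laws at every
sequence + the §2 dichotomy at the LIVE sequences of `𝐓ρ_k`», `k < K`, and the displayed signs ∕ non-negative history: `∀ k ≤ K, SLaw₁₂ (θ.liveRepin) p k` (induction from
node00-def-T's start `sLaw₁₂_zero`). [cite: Balaban1988Convergent, Thm 1 p.262; Theorem p.245; p.244; Balaban1989LargeFieldI, (0.3) p.176, p.177 (i)–(ii)] -/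
theorem sLaw₁₂_all_liveRepin_of_thmP245Live (h : (θ.liveRepin F N).Provisos₁₂ F N) (hθ : θ.Admissible F N) (hκ : 0 ≤ θ.s2.lf.κ)
    (hE₀ : 0 ≤ θ.s2.lf.E₀) (hB₀ : 0 ≤ θ.s2.lf.B₀) (hg : ∀ k, k < p.K → 0 ≤ gOfRecord₁₀ F N θ.toStage9Params p (k + 1))
    (hT : ∀ k, k < p.K → SLaw₁₂ F N (θ.liveRepin F N) p k →
      ∃ (t : SeqOfRecord F θ.ν θ.τ9.M (gOfRecord₁₀ F N θ.toStage9Params p) p.K (k + 1) → Sect2.TermValues (F.P p.K) (MatA N) (FluctV N) θ.τ9.M)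
      (Ek : SeqOfRecord F θ.ν θ.τ9.M (gOfRecord₁₀ F N θ.toStage9Params p) p.K (k + 1) → ℝ), Sect2.UniversalE t ∧
      ∀ s, Sect2.LawsT (sect2TowerOfRecord F N (FluctV N) p.K (settingOfRecord₁₂ F N (θ.liveRepin F N) p) (θ.Rz p.K) s (t s))
          (settingOfRecord₁₂ F N (θ.liveRepin F N) p).lf (settingOfRecord₁₂ F N (θ.liveRepin F N) p).βc k ∧
        (LiveSeq F N θ.ν θ.τ9 p (gOfRecord₁₀ F N θ.toStage9Params p) (k + 1)
            (slotsTOfRecord F N θ.ν θ.τ9 (EOfRecord₁₀ F N θ.toStage9Params) (wOfRecord₉ F N θ.toStage9Params) (θ.liveRepin F N).ppSel p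
              (gOfRecord₁₀ F N θ.toStage9Params p) (k + 1)) s →
          (slotsTOfRecord F N θ.ν θ.τ9 (EOfRecord₁₀ F N θ.toStage9Params) (wOfRecord₉ F N θ.toStage9Params) (θ.liveRepin F N).ppSel p
              (gOfRecord₁₀ F N θ.toStage9Params p) (k + 1) s = 0 ∨
            ∀ᵐ V ∂(fieldMeasure (F.P p.K) (k + 1) (SU N)),
              chiSeqOfRecord F N θ.ν θ.τ9.M (gOfRecord₁₀ F N θ.toStage9Params p) p.K (k + 1) s V ≠ 0 →
              slotsTOfRecord F N θ.ν θ.τ9 (EOfRecord₁₀ F N θ.toStage9Params) (wOfRecord₉ F N θ.toStage9Params) (θ.liveRepin F N).ppSel p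
                  (gOfRecord₁₀ F N θ.toStage9Params p) (k + 1) s V
                = sect2Slot F N (FluctV N) p.K (settingOfRecord₁₂ F N (θ.liveRepin F N) p) (θ.Rz p.K) (WtOfRecord₁₂ F N (θ.liveRepin F N) p) s (t s) (Ek s)
                    (UbgOfRecord₁₂ F N (θ.liveRepin F N) p (k + 1) s) V))) :
    ∀ k, k ≤ p.K → SLaw₁₂ F N (θ.liveRepin F N) p k := by
  intro k
  induction k with
  | zero => exact fun _ => sLaw₁₂_zero F N (θ.liveRepin F N) p
  | succ n ih =>
    intro hk
    exact sLaw₁₂_succ_liveRepin_of_tLawLive F N θ p h hθ hκ hE₀ hB₀ n (Nat.lt_of_succ_le hk) (hg n (Nat.lt_of_succ_le hk))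
      (hT n (Nat.lt_of_succ_le hk) (ih (Nat.le_of_succ_le hk)))

end LiveOnlyRepin

section LiveOnlyFaces

variable (θ : Stage12Params F N) (p : B12.RunParams) (w : WorldP) (h : (θ.liveRepin F N).Provisos₁₂ F N)

/-- **Theorem 1's conclusion `densitiesDescribed` AT A WORLD BOUND TO THE LIVE-RE-PINNED DATUM, from (S1ᵀ) AT THE LIVE SEQUENCES ONLY** (+ signs, non-negative
history; `densitiesDescribed_iff_core` ∘ `sLaw₁₂_all_liveRepin_of_thmP245Live`). [cite: Balaban1988Convergent, Thm 1 p.262; Theorem p.245; p.244] -/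
theorem densitiesDescribed_at_record₁₂_liveRepin_of_lawsLive (hC : w.C = (datumOfRecord₁₂ F N (θ.liveRepin F N) h).C) (hθ : θ.Admissible F N)
    (hκ : 0 ≤ θ.s2.lf.κ) (hE₀ : 0 ≤ θ.s2.lf.E₀) (hB₀ : 0 ≤ θ.s2.lf.B₀) (hg : ∀ k, k < p.K → 0 ≤ gOfRecord₁₀ F N θ.toStage9Params p (k + 1))
    (hT : ∀ k, k < p.K → SLaw₁₂ F N (θ.liveRepin F N) p k →
      ∃ (t : SeqOfRecord F θ.ν θ.τ9.M (gOfRecord₁₀ F N θ.toStage9Params p) p.K (k + 1) → Sect2.TermValues (F.P p.K) (MatA N) (FluctV N) θ.τ9.M)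
      (Ek : SeqOfRecord F θ.ν θ.τ9.M (gOfRecord₁₀ F N θ.toStage9Params p) p.K (k + 1) → ℝ), Sect2.UniversalE t ∧
      ∀ s, Sect2.LawsT (sect2TowerOfRecord F N (FluctV N) p.K (settingOfRecord₁₂ F N (θ.liveRepin F N) p) (θ.Rz p.K) s (t s))
          (settingOfRecord₁₂ F N (θ.liveRepin F N) p).lf (settingOfRecord₁₂ F N (θ.liveRepin F N) p).βc k ∧
        (LiveSeq F N θ.ν θ.τ9 p (gOfRecord₁₀ F N θ.toStage9Params p) (k + 1)
            (slotsTOfRecord F N θ.ν θ.τ9 (EOfRecord₁₀ F N θ.toStage9Params) (wOfRecord₉ F N θ.toStage9Params) (θ.liveRepin F N).ppSel p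
              (gOfRecord₁₀ F N θ.toStage9Params p) (k + 1)) s →
          (slotsTOfRecord F N θ.ν θ.τ9 (EOfRecord₁₀ F N θ.toStage9Params) (wOfRecord₉ F N θ.toStage9Params) (θ.liveRepin F N).ppSel p
              (gOfRecord₁₀ F N θ.toStage9Params p) (k + 1) s = 0 ∨
            ∀ᵐ V ∂(fieldMeasure (F.P p.K) (k + 1) (SU N)),
              chiSeqOfRecord F N θ.ν θ.τ9.M (gOfRecord₁₀ F N θ.toStage9Params p) p.K (k + 1) s V ≠ 0 →
              slotsTOfRecord F N θ.ν θ.τ9 (EOfRecord₁₀ F N θ.toStage9Params) (wOfRecord₉ F N θ.toStage9Params) (θ.liveRepin F N).ppSel p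
              (gOfRecord₁₀ F N θ.toStage9Params p) (k + 1) s V
                = sect2Slot F N (FluctV N) p.K (settingOfRecord₁₂ F N (θ.liveRepin F N) p) (θ.Rz p.K) (WtOfRecord₁₂ F N (θ.liveRepin F N) p) s (t s) (Ek s)
                    (UbgOfRecord₁₂ F N (θ.liveRepin F N) p (k + 1) s) V))) :
    (leavesP w p).densitiesDescribed :=
  (densitiesDescribed_iff_core F N (coreOfRecord₁₂ F N (θ.liveRepin F N)) (towerOfRecord₁₂ F N (θ.liveRepin F N) h) w p hC).2
    (sLaw₁₂_all_liveRepin_of_thmP245Live F N θ p h hθ hκ hE₀ hB₀ hg hT)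

/-- **★ N11 · `Dag.B14_main (leavesP w P)` AT A WORLD BOUND TO A LIVE-RE-PINNED DATUM FROM (S1ᵀ) AT THE LIVE SEQUENCES ONLY** — one displayed slot: the Theorem of
p. 245's 𝐓-image laws at every sequence and its §2 identity ONLY AT THE LIVE SEQUENCES of `𝐓ρ_k`, GIVEN the node's in-edges, the interval hypothesis (which supplies
`0 ≤ g_{k+1}`), the small-field inductive assumptions and the flow control; NO 𝐑-reading hypothesis, NO selector clause.  Count-neutral slot landing.
[cite: Balaban1988Convergent, Thm 1 p.262; Theorem p.245; p.244; (2.6) p.255] -/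
theorem b14_main_at_record₁₂_liveRepin_of_lawsLive (hC : w.C = (datumOfRecord₁₂ F N (θ.liveRepin F N) h).C) (hθ : θ.Admissible F N)
    (hκ : 0 ≤ θ.s2.lf.κ) (hE₀ : 0 ≤ θ.s2.lf.E₀) (hB₀ : 0 ≤ θ.s2.lf.B₀)
    (hT : (leavesP w p).b7 → (leavesP w p).b8 → (leavesP w p).b9 → (leavesP w p).b10 → (leavesP w p).b11 →
      (leavesP w p).smallCouplings → (leavesP w p).smallFieldInductive → (leavesP w p).flowControl →
      ∀ k, k < p.K → SLaw₁₂ F N (θ.liveRepin F N) p k →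
      ∃ (t : SeqOfRecord F θ.ν θ.τ9.M (gOfRecord₁₀ F N θ.toStage9Params p) p.K (k + 1) → Sect2.TermValues (F.P p.K) (MatA N) (FluctV N) θ.τ9.M)
      (Ek : SeqOfRecord F θ.ν θ.τ9.M (gOfRecord₁₀ F N θ.toStage9Params p) p.K (k + 1) → ℝ), Sect2.UniversalE t ∧
      ∀ s, Sect2.LawsT (sect2TowerOfRecord F N (FluctV N) p.K (settingOfRecord₁₂ F N (θ.liveRepin F N) p) (θ.Rz p.K) s (t s))
          (settingOfRecord₁₂ F N (θ.liveRepin F N) p).lf (settingOfRecord₁₂ F N (θ.liveRepin F N) p).βc k ∧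
        (LiveSeq F N θ.ν θ.τ9 p (gOfRecord₁₀ F N θ.toStage9Params p) (k + 1)
            (slotsTOfRecord F N θ.ν θ.τ9 (EOfRecord₁₀ F N θ.toStage9Params) (wOfRecord₉ F N θ.toStage9Params) (θ.liveRepin F N).ppSel p
              (gOfRecord₁₀ F N θ.toStage9Params p) (k + 1)) s →
          (slotsTOfRecord F N θ.ν θ.τ9 (EOfRecord₁₀ F N θ.toStage9Params) (wOfRecord₉ F N θ.toStage9Params) (θ.liveRepin F N).ppSel p
              (gOfRecord₁₀ F N θ.toStage9Params p) (k + 1) s = 0 ∨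
            ∀ᵐ V ∂(fieldMeasure (F.P p.K) (k + 1) (SU N)),
              chiSeqOfRecord F N θ.ν θ.τ9.M (gOfRecord₁₀ F N θ.toStage9Params p) p.K (k + 1) s V ≠ 0 →
              slotsTOfRecord F N θ.ν θ.τ9 (EOfRecord₁₀ F N θ.toStage9Params) (wOfRecord₉ F N θ.toStage9Params) (θ.liveRepin F N).ppSel p
              (gOfRecord₁₀ F N θ.toStage9Params p) (k + 1) s V
                = sect2Slot F N (FluctV N) p.K (settingOfRecord₁₂ F N (θ.liveRepin F N) p) (θ.Rz p.K) (WtOfRecord₁₂ F N (θ.liveRepin F N) p) s (t s) (Ek s)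
                    (UbgOfRecord₁₂ F N (θ.liveRepin F N) p (k + 1) s) V))) :
    Dag.B14_main (leavesP w p) := by
  intro h7 h8 h9 h10 h11 hsf hfc _ hsc
  have hg : ∀ k, k < p.K → 0 ≤ gOfRecord₁₀ F N θ.toStage9Params p (k + 1) := fun k hk => by
    have hgk : 0 < (w.C p).flow.g (k + 1) := (hsc (k + 1) hk).1
    rw [hC, flow_g_datumOfRecord₁₂] at hgk
    exact hgk.le
  exact densitiesDescribed_at_record₁₂_liveRepin_of_lawsLive F N θ p w h hC hθ hκ hE₀ hB₀ hg (hT h7 h8 h9 h10 h11 hsc (hsf hsc) (hfc hsc))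

/-- **`B16.InductionStep` AT THE LIVE-RE-PINNED DATUM FROM (S1ᵀ) AT THE LIVE SEQUENCES ONLY** (node00-def-T's `inductionStep_datumOfRecord₁₂_of_tLaw_rOpLeaf` with BOTH the
𝐑-leaf and the dead-sequence part of the 𝐓-law REMOVED: along every windowed run, «§2 form at `k` ⇒ 𝐓-image laws + §2 identity at the live sequences» gives «§2 form at
`k+1`»). [cite: Balaban1989LargeFieldII, Thm 1 p.355 and pp.390–391; Balaban1988Convergent, Thm p.245, Thm 2 p.263] -/
theorem inductionStep_datumOfRecord₁₂_liveRepin_of_tLawLive (hθ : θ.Admissible F N) (hκ : 0 ≤ θ.s2.lf.κ) (hE₀ : 0 ≤ θ.s2.lf.E₀)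
    (hB₀ : 0 ≤ θ.s2.lf.B₀) (γ : ℝ)
    (hT : ∀ P : B12.RunParams, ((datumOfRecord₁₂ F N (θ.liveRepin F N) h).C P).flow.InInterval γ P.K →
      ∀ k, k < P.K → SLaw₁₂ F N (θ.liveRepin F N) P k →
      ∃ (t : SeqOfRecord F θ.ν θ.τ9.M (gOfRecord₁₀ F N θ.toStage9Params P) P.K (k + 1) → Sect2.TermValues (F.P P.K) (MatA N) (FluctV N) θ.τ9.M)
      (Ek : SeqOfRecord F θ.ν θ.τ9.M (gOfRecord₁₀ F N θ.toStage9Params P) P.K (k + 1) → ℝ), Sect2.UniversalE t ∧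
      ∀ s, Sect2.LawsT (sect2TowerOfRecord F N (FluctV N) P.K (settingOfRecord₁₂ F N (θ.liveRepin F N) P) (θ.Rz P.K) s (t s))
          (settingOfRecord₁₂ F N (θ.liveRepin F N) P).lf (settingOfRecord₁₂ F N (θ.liveRepin F N) P).βc k ∧
        (LiveSeq F N θ.ν θ.τ9 P (gOfRecord₁₀ F N θ.toStage9Params P) (k + 1)
            (slotsTOfRecord F N θ.ν θ.τ9 (EOfRecord₁₀ F N θ.toStage9Params) (wOfRecord₉ F N θ.toStage9Params) (θ.liveRepin F N).ppSel P
              (gOfRecord₁₀ F N θ.toStage9Params P) (k + 1)) s →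
          (slotsTOfRecord F N θ.ν θ.τ9 (EOfRecord₁₀ F N θ.toStage9Params) (wOfRecord₉ F N θ.toStage9Params) (θ.liveRepin F N).ppSel P
              (gOfRecord₁₀ F N θ.toStage9Params P) (k + 1) s = 0 ∨
            ∀ᵐ V ∂(fieldMeasure (F.P P.K) (k + 1) (SU N)),
              chiSeqOfRecord F N θ.ν θ.τ9.M (gOfRecord₁₀ F N θ.toStage9Params P) P.K (k + 1) s V ≠ 0 →
              slotsTOfRecord F N θ.ν θ.τ9 (EOfRecord₁₀ F N θ.toStage9Params) (wOfRecord₉ F N θ.toStage9Params) (θ.liveRepin F N).ppSel P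
              (gOfRecord₁₀ F N θ.toStage9Params P) (k + 1) s V
                = sect2Slot F N (FluctV N) P.K (settingOfRecord₁₂ F N (θ.liveRepin F N) P) (θ.Rz P.K) (WtOfRecord₁₂ F N (θ.liveRepin F N) P) s (t s) (Ek s)
                    (UbgOfRecord₁₂ F N (θ.liveRepin F N) P (k + 1) s) V))) :
    B16.InductionStep (datumOfRecord₁₂ F N (θ.liveRepin F N) h).C γ := by
  intro P hP k hk hS
  have hS' : SLaw₁₂ F N (θ.liveRepin F N) P k :=
    (sLaw₁₂_iff F N (θ.liveRepin F N) P k).mpr ((sect2Form_stage12_iff F N (θ.liveRepin F N) h P k).mp hS)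
  have hgk : 0 ≤ gOfRecord₁₀ F N θ.toStage9Params P (k + 1) := by
    have hg := (hP (k + 1) hk).1
    rw [flow_g_datumOfRecord₁₂] at hg
    exact hg.le
  exact (sect2Form_stage12_iff F N (θ.liveRepin F N) h P (k + 1)).mpr
    ((sLaw₁₂_iff F N (θ.liveRepin F N) P (k + 1)).mp
      (sLaw₁₂_succ_liveRepin_of_tLawLive F N θ P h hθ hκ hE₀ hB₀ k hk hgk (hT P hP k hk hS')))

/-- **★ THE ROUTE's K1′ (B)-FACE FIRST CONJUNCT `B16.Thm1Printed (datumOfRecord₁₂ F N (θ.liveRepin F N) h).C` FROM (S1ᵀ) AT THE LIVE SEQUENCES ONLY, along the windowed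
runs** (`B16.thm1_of_steps` with node00-def-T's base `inductionBase_datumOfRecord₁₂` and the step above): on the witness line N11 owes the Theorem of p. 245's laws and
its §2 identity AT THE LIVE SEQUENCES — nothing at the dead ones, no 𝐑, no selector clause. [cite: Balaban1989LargeFieldII, Thm 1 p.355; Balaban1988Convergent, Thm 1 p.262; Theorem p.245] -/
theorem thm1Printed_datumOfRecord₁₂_liveRepin_of_lawsLive (hθ : θ.Admissible F N) (hκ : 0 ≤ θ.s2.lf.κ) (hE₀ : 0 ≤ θ.s2.lf.E₀)
    (hB₀ : 0 ≤ θ.s2.lf.B₀) {γ : ℝ} (hγ : 0 < γ)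
    (hT : ∀ P : B12.RunParams, ((datumOfRecord₁₂ F N (θ.liveRepin F N) h).C P).flow.InInterval γ P.K →
      ∀ k, k < P.K → SLaw₁₂ F N (θ.liveRepin F N) P k →
      ∃ (t : SeqOfRecord F θ.ν θ.τ9.M (gOfRecord₁₀ F N θ.toStage9Params P) P.K (k + 1) → Sect2.TermValues (F.P P.K) (MatA N) (FluctV N) θ.τ9.M)
      (Ek : SeqOfRecord F θ.ν θ.τ9.M (gOfRecord₁₀ F N θ.toStage9Params P) P.K (k + 1) → ℝ), Sect2.UniversalE t ∧
      ∀ s, Sect2.LawsT (sect2TowerOfRecord F N (FluctV N) P.K (settingOfRecord₁₂ F N (θ.liveRepin F N) P) (θ.Rz P.K) s (t s))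
          (settingOfRecord₁₂ F N (θ.liveRepin F N) P).lf (settingOfRecord₁₂ F N (θ.liveRepin F N) P).βc k ∧
        (LiveSeq F N θ.ν θ.τ9 P (gOfRecord₁₀ F N θ.toStage9Params P) (k + 1)
            (slotsTOfRecord F N θ.ν θ.τ9 (EOfRecord₁₀ F N θ.toStage9Params) (wOfRecord₉ F N θ.toStage9Params) (θ.liveRepin F N).ppSel P
              (gOfRecord₁₀ F N θ.toStage9Params P) (k + 1)) s →
          (slotsTOfRecord F N θ.ν θ.τ9 (EOfRecord₁₀ F N θ.toStage9Params) (wOfRecord₉ F N θ.toStage9Params) (θ.liveRepin F N).ppSel P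
              (gOfRecord₁₀ F N θ.toStage9Params P) (k + 1) s = 0 ∨
            ∀ᵐ V ∂(fieldMeasure (F.P P.K) (k + 1) (SU N)),
              chiSeqOfRecord F N θ.ν θ.τ9.M (gOfRecord₁₀ F N θ.toStage9Params P) P.K (k + 1) s V ≠ 0 →
              slotsTOfRecord F N θ.ν θ.τ9 (EOfRecord₁₀ F N θ.toStage9Params) (wOfRecord₉ F N θ.toStage9Params) (θ.liveRepin F N).ppSel P
              (gOfRecord₁₀ F N θ.toStage9Params P) (k + 1) s V
                = sect2Slot F N (FluctV N) P.K (settingOfRecord₁₂ F N (θ.liveRepin F N) P) (θ.Rz P.K) (WtOfRecord₁₂ F N (θ.liveRepin F N) P) s (t s) (Ek s)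
                    (UbgOfRecord₁₂ F N (θ.liveRepin F N) P (k + 1) s) V))) :
    B16.Thm1Printed (datumOfRecord₁₂ F N (θ.liveRepin F N) h).C :=
  B16.thm1_of_steps _ γ hγ (inductionBase_datumOfRecord₁₂ F N (θ.liveRepin F N) h γ)
    (inductionStep_datumOfRecord₁₂_liveRepin_of_tLawLive F N θ h hθ hκ hE₀ hB₀ γ hT)

end LiveOnlyFaces

section LiveOnlyTheta

variable (ζ : ZetaOfRecord F N numerics7OfRecord₁₂ 1) (Rz : (K : ℕ) → Sect2.Residual (F.P K) (MatA N)) (Zt : (K : ℕ) → TkResidualW F N (FluctV N) K)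
variable (p : B12.RunParams) (w : WorldP) (h : (theta12LiveOfRecord F N ζ Rz Zt).Provisos₁₂ F N)

/-- **N11 · `Dag.B14_main (leavesP w P)` AT A WORLD BOUND TO THE DATUM OF `θ₀ˡⁱᵛᵉ` FROM (S1ᵀ) AT THE LIVE SEQUENCES ONLY** (admissibility and signs discharged at the numerics
of record). [cite: Balaban1988Convergent, Thm 1 p.262; Theorem p.245; p.244; (2.6) p.255] -/
theorem b14_main_at_record₁₂_theta12LiveOfRecord_of_lawsLive (hC : w.C = (datumOfRecord₁₂ F N (theta12LiveOfRecord F N ζ Rz Zt) h).C)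
    (hT : (leavesP w p).b7 → (leavesP w p).b8 → (leavesP w p).b9 → (leavesP w p).b10 → (leavesP w p).b11 →
      (leavesP w p).smallCouplings → (leavesP w p).smallFieldInductive → (leavesP w p).flowControl →
      ∀ k, k < p.K → SLaw₁₂ F N (theta12LiveOfRecord F N ζ Rz Zt) p k →
      ∃ (t : SeqOfRecord F (theta12OfRecord F N ζ Rz Zt).ν (theta12OfRecord F N ζ Rz Zt).τ9.M (gOfRecord₁₀ F N (theta12OfRecord F N ζ Rz Zt).toStage9Params p) p.K (k + 1) → Sect2.TermValues (F.P p.K) (MatA N) (FluctV N) (theta12OfRecord F N ζ Rz Zt).τ9.M)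
      (Ek : SeqOfRecord F (theta12OfRecord F N ζ Rz Zt).ν (theta12OfRecord F N ζ Rz Zt).τ9.M (gOfRecord₁₀ F N (theta12OfRecord F N ζ Rz Zt).toStage9Params p) p.K (k + 1) → ℝ), Sect2.UniversalE t ∧
      ∀ s, Sect2.LawsT (sect2TowerOfRecord F N (FluctV N) p.K (settingOfRecord₁₂ F N (theta12LiveOfRecord F N ζ Rz Zt) p) ((theta12OfRecord F N ζ Rz Zt).Rz p.K) s (t s))
          (settingOfRecord₁₂ F N (theta12LiveOfRecord F N ζ Rz Zt) p).lf (settingOfRecord₁₂ F N (theta12LiveOfRecord F N ζ Rz Zt) p).βc k ∧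
        (LiveSeq F N (theta12OfRecord F N ζ Rz Zt).ν (theta12OfRecord F N ζ Rz Zt).τ9 p (gOfRecord₁₀ F N (theta12OfRecord F N ζ Rz Zt).toStage9Params p) (k + 1)
            (slotsTOfRecord F N (theta12OfRecord F N ζ Rz Zt).ν (theta12OfRecord F N ζ Rz Zt).τ9 (EOfRecord₁₀ F N (theta12OfRecord F N ζ Rz Zt).toStage9Params) (wOfRecord₉ F N (theta12OfRecord F N ζ Rz Zt).toStage9Params) (theta12LiveOfRecord F N ζ Rz Zt).ppSel p
              (gOfRecord₁₀ F N (theta12OfRecord F N ζ Rz Zt).toStage9Params p) (k + 1)) s →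
          (slotsTOfRecord F N (theta12OfRecord F N ζ Rz Zt).ν (theta12OfRecord F N ζ Rz Zt).τ9 (EOfRecord₁₀ F N (theta12OfRecord F N ζ Rz Zt).toStage9Params) (wOfRecord₉ F N (theta12OfRecord F N ζ Rz Zt).toStage9Params) (theta12LiveOfRecord F N ζ Rz Zt).ppSel p
              (gOfRecord₁₀ F N (theta12OfRecord F N ζ Rz Zt).toStage9Params p) (k + 1) s = 0 ∨
            ∀ᵐ V ∂(fieldMeasure (F.P p.K) (k + 1) (SU N)),
              chiSeqOfRecord F N (theta12OfRecord F N ζ Rz Zt).ν (theta12OfRecord F N ζ Rz Zt).τ9.M (gOfRecord₁₀ F N (theta12OfRecord F N ζ Rz Zt).toStage9Params p) p.K (k + 1) s V ≠ 0 →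
              slotsTOfRecord F N (theta12OfRecord F N ζ Rz Zt).ν (theta12OfRecord F N ζ Rz Zt).τ9 (EOfRecord₁₀ F N (theta12OfRecord F N ζ Rz Zt).toStage9Params) (wOfRecord₉ F N (theta12OfRecord F N ζ Rz Zt).toStage9Params) (theta12LiveOfRecord F N ζ Rz Zt).ppSel p
              (gOfRecord₁₀ F N (theta12OfRecord F N ζ Rz Zt).toStage9Params p) (k + 1) s V
                = sect2Slot F N (FluctV N) p.K (settingOfRecord₁₂ F N (theta12LiveOfRecord F N ζ Rz Zt) p) ((theta12OfRecord F N ζ Rz Zt).Rz p.K) (WtOfRecord₁₂ F N (theta12LiveOfRecord F N ζ Rz Zt) p) s (t s) (Ek s)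
                    (UbgOfRecord₁₂ F N (theta12LiveOfRecord F N ζ Rz Zt) p (k + 1) s) V))) :
    Dag.B14_main (leavesP w p) :=
  b14_main_at_record₁₂_liveRepin_of_lawsLive F N (theta12OfRecord F N ζ Rz Zt) p w h hC (admissible_theta12OfRecord F N ζ Rz Zt)
    (kappa_nonneg_theta12OfRecord F N ζ Rz Zt) (E0_nonneg_theta12OfRecord F N ζ Rz Zt) (B0_nonneg_theta12OfRecord F N ζ Rz Zt) hT

/-- **★ `B16.Thm1Printed (datumOfRecord₁₂ F N θ₀ˡⁱᵛᵉ h).C` FROM (S1ᵀ) AT THE LIVE SEQUENCES ONLY, along the windowed runs** — the (B)-face's first conjunct on the K0′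
witness line with N11's share reduced to the 𝐓-image laws + the §2 identity at the live sequences; admissibility and signs discharged.
[cite: Balaban1989LargeFieldII, Thm 1 p.355; Balaban1988Convergent, Thm 1 p.262; Theorem p.245] -/
theorem thm1Printed_datumOfRecord₁₂_theta12LiveOfRecord_of_lawsLive {γ : ℝ} (hγ : 0 < γ)
    (hT : ∀ P : B12.RunParams, ((datumOfRecord₁₂ F N (theta12LiveOfRecord F N ζ Rz Zt) h).C P).flow.InInterval γ P.K →
      ∀ k, k < P.K → SLaw₁₂ F N (theta12LiveOfRecord F N ζ Rz Zt) P k →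
      ∃ (t : SeqOfRecord F (theta12OfRecord F N ζ Rz Zt).ν (theta12OfRecord F N ζ Rz Zt).τ9.M (gOfRecord₁₀ F N (theta12OfRecord F N ζ Rz Zt).toStage9Params P) P.K (k + 1) → Sect2.TermValues (F.P P.K) (MatA N) (FluctV N) (theta12OfRecord F N ζ Rz Zt).τ9.M)
      (Ek : SeqOfRecord F (theta12OfRecord F N ζ Rz Zt).ν (theta12OfRecord F N ζ Rz Zt).τ9.M (gOfRecord₁₀ F N (theta12OfRecord F N ζ Rz Zt).toStage9Params P) P.K (k + 1) → ℝ), Sect2.UniversalE t ∧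
      ∀ s, Sect2.LawsT (sect2TowerOfRecord F N (FluctV N) P.K (settingOfRecord₁₂ F N (theta12LiveOfRecord F N ζ Rz Zt) P) ((theta12OfRecord F N ζ Rz Zt).Rz P.K) s (t s))
          (settingOfRecord₁₂ F N (theta12LiveOfRecord F N ζ Rz Zt) P).lf (settingOfRecord₁₂ F N (theta12LiveOfRecord F N ζ Rz Zt) P).βc k ∧
        (LiveSeq F N (theta12OfRecord F N ζ Rz Zt).ν (theta12OfRecord F N ζ Rz Zt).τ9 P (gOfRecord₁₀ F N (theta12OfRecord F N ζ Rz Zt).toStage9Params P) (k + 1)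
            (slotsTOfRecord F N (theta12OfRecord F N ζ Rz Zt).ν (theta12OfRecord F N ζ Rz Zt).τ9 (EOfRecord₁₀ F N (theta12OfRecord F N ζ Rz Zt).toStage9Params) (wOfRecord₉ F N (theta12OfRecord F N ζ Rz Zt).toStage9Params) (theta12LiveOfRecord F N ζ Rz Zt).ppSel P
              (gOfRecord₁₀ F N (theta12OfRecord F N ζ Rz Zt).toStage9Params P) (k + 1)) s →
          (slotsTOfRecord F N (theta12OfRecord F N ζ Rz Zt).ν (theta12OfRecord F N ζ Rz Zt).τ9 (EOfRecord₁₀ F N (theta12OfRecord F N ζ Rz Zt).toStage9Params) (wOfRecord₉ F N (theta12OfRecord F N ζ Rz Zt).toStage9Params) (theta12LiveOfRecord F N ζ Rz Zt).ppSel P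
              (gOfRecord₁₀ F N (theta12OfRecord F N ζ Rz Zt).toStage9Params P) (k + 1) s = 0 ∨
            ∀ᵐ V ∂(fieldMeasure (F.P P.K) (k + 1) (SU N)),
              chiSeqOfRecord F N (theta12OfRecord F N ζ Rz Zt).ν (theta12OfRecord F N ζ Rz Zt).τ9.M (gOfRecord₁₀ F N (theta12OfRecord F N ζ Rz Zt).toStage9Params P) P.K (k + 1) s V ≠ 0 →
              slotsTOfRecord F N (theta12OfRecord F N ζ Rz Zt).ν (theta12OfRecord F N ζ Rz Zt).τ9 (EOfRecord₁₀ F N (theta12OfRecord F N ζ Rz Zt).toStage9Params) (wOfRecord₉ F N (theta12OfRecord F N ζ Rz Zt).toStage9Params) (theta12LiveOfRecord F N ζ Rz Zt).ppSel P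
              (gOfRecord₁₀ F N (theta12OfRecord F N ζ Rz Zt).toStage9Params P) (k + 1) s V
                = sect2Slot F N (FluctV N) P.K (settingOfRecord₁₂ F N (theta12LiveOfRecord F N ζ Rz Zt) P) ((theta12OfRecord F N ζ Rz Zt).Rz P.K) (WtOfRecord₁₂ F N (theta12LiveOfRecord F N ζ Rz Zt) P) s (t s) (Ek s)
                    (UbgOfRecord₁₂ F N (theta12LiveOfRecord F N ζ Rz Zt) P (k + 1) s) V))) :
    B16.Thm1Printed (datumOfRecord₁₂ F N (theta12LiveOfRecord F N ζ Rz Zt) h).C :=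
  thm1Printed_datumOfRecord₁₂_liveRepin_of_lawsLive F N (theta12OfRecord F N ζ Rz Zt) h (admissible_theta12OfRecord F N ζ Rz Zt)
    (kappa_nonneg_theta12OfRecord F N ζ Rz Zt) (E0_nonneg_theta12OfRecord F N ζ Rz Zt) (B0_nonneg_theta12OfRecord F N ζ Rz Zt) hγ hT

end LiveOnlyTheta

/-! ## §5  (v1.1) The sign `0 ≤ g_{k+1}` is FREE along every generated history (the (0.20) forward solution is `1∕√y` or `0`) — the `hg` binders above discharged -/

section FreeSign

/-- The (0.20) forward solution is non-negative: `solveCoupling y = 1∕√y` (`y > 0`) or `0`.  (Seat dag-n12-d announces the same fact Summits-side as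
`solveCoupling_nonneg`; this is the Literature-side copy its Literature consumers can import.) [cite: Balaban1987RG1, (0.20) p.256 (bookkeeping)] -/
theorem solveCoupling_nonneg (y : ℝ) : 0 ≤ FlowStepRuns.solveCoupling y := by
  unfold FlowStepRuns.solveCoupling
  split_ifs with h
  · positivity
  · exact le_rfl

/-- **EVERY GENERATED COUPLING OF POSITIVE LEVEL IS NON-NEGATIVE**: `gOfRecord₁₀ θ p (k+1) = genSeq β g₀ (k+1) = solveCoupling (…) ≥ 0` — so the displayed sign
`0 ≤ g_{k+1}` of `…B16RLeafRecord12Live` §2 and of §2–§4 above holds at EVERY Stage-9 tuple, window or not. [cite: Balaban1987RG1, (0.17)–(0.20) pp.255–256 (bookkeeping)] -/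
theorem gOfRecord₁₀_succ_nonneg (θ' : Stage9Params F N) (p : B12.RunParams) (k : ℕ) : 0 ≤ gOfRecord₁₀ F N θ' p (k + 1) := by
  show 0 ≤ FlowStepRuns.genSeq _ _ (k + 1)
  rw [FlowStepRuns.genSeq_succ]
  exact solveCoupling_nonneg _

variable (θ : Stage12Params F N) (p : B12.RunParams)

/-- **★ THE 𝐑-LEAF OF RECORD AT A LIVE RE-PIN, SIGN-FREE FORM**: `rOpLeaf_VOfRecord₁₂_liveRepin` with `0 ≤ g_{k+1}` discharged by `gOfRecord₁₀_succ_nonneg` — hypotheses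
left: the provisos at the re-pin, admissibility and the term-constant signs of `θ`. [cite: Balaban1988Convergent, p.244, Thm 2 p.263; Balaban1989LargeFieldI, (0.3) p.176, p.177 (i)–(ii)] -/
theorem rOpLeaf_VOfRecord₁₂_liveRepin_signFree (h : (θ.liveRepin F N).Provisos₁₂ F N) (hθ : θ.Admissible F N) (hκ : 0 ≤ θ.s2.lf.κ)
    (hE₀ : 0 ≤ θ.s2.lf.E₀) (hB₀ : 0 ≤ θ.s2.lf.B₀) : ROpLeaf (VOfRecord₁₂ F N (θ.liveRepin F N) p) :=
  rOpLeaf_VOfRecord₁₂_liveRepin F N θ p h hθ hκ hE₀ hB₀ fun k _ => gOfRecord₁₀_succ_nonneg F N θ.toStage9Params p k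

/-- **THEOREM 1 [III] AT THE LIVE-RE-PINNED OBJECTS FROM (S1ᵀ) AT THE LIVE SEQUENCES ONLY, SIGN-FREE FORM.** [cite: Balaban1988Convergent, Thm 1 p.262; Theorem p.245] -/
theorem sLaw₁₂_all_liveRepin_of_thmP245Live_signFree (h : (θ.liveRepin F N).Provisos₁₂ F N) (hθ : θ.Admissible F N) (hκ : 0 ≤ θ.s2.lf.κ)
    (hE₀ : 0 ≤ θ.s2.lf.E₀) (hB₀ : 0 ≤ θ.s2.lf.B₀)
    (hT : ∀ k, k < p.K → SLaw₁₂ F N (θ.liveRepin F N) p k →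
      ∃ (t : SeqOfRecord F θ.ν θ.τ9.M (gOfRecord₁₀ F N θ.toStage9Params p) p.K (k + 1) → Sect2.TermValues (F.P p.K) (MatA N) (FluctV N) θ.τ9.M)
      (Ek : SeqOfRecord F θ.ν θ.τ9.M (gOfRecord₁₀ F N θ.toStage9Params p) p.K (k + 1) → ℝ), Sect2.UniversalE t ∧
      ∀ s, Sect2.LawsT (sect2TowerOfRecord F N (FluctV N) p.K (settingOfRecord₁₂ F N (θ.liveRepin F N) p) (θ.Rz p.K) s (t s))
          (settingOfRecord₁₂ F N (θ.liveRepin F N) p).lf (settingOfRecord₁₂ F N (θ.liveRepin F N) p).βc k ∧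
        (LiveSeq F N θ.ν θ.τ9 p (gOfRecord₁₀ F N θ.toStage9Params p) (k + 1)
            (slotsTOfRecord F N θ.ν θ.τ9 (EOfRecord₁₀ F N θ.toStage9Params) (wOfRecord₉ F N θ.toStage9Params) (θ.liveRepin F N).ppSel p
              (gOfRecord₁₀ F N θ.toStage9Params p) (k + 1)) s →
          (slotsTOfRecord F N θ.ν θ.τ9 (EOfRecord₁₀ F N θ.toStage9Params) (wOfRecord₉ F N θ.toStage9Params) (θ.liveRepin F N).ppSel p
              (gOfRecord₁₀ F N θ.toStage9Params p) (k + 1) s = 0 ∨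
            ∀ᵐ V ∂(fieldMeasure (F.P p.K) (k + 1) (SU N)),
              chiSeqOfRecord F N θ.ν θ.τ9.M (gOfRecord₁₀ F N θ.toStage9Params p) p.K (k + 1) s V ≠ 0 →
              slotsTOfRecord F N θ.ν θ.τ9 (EOfRecord₁₀ F N θ.toStage9Params) (wOfRecord₉ F N θ.toStage9Params) (θ.liveRepin F N).ppSel p
                  (gOfRecord₁₀ F N θ.toStage9Params p) (k + 1) s V
                = sect2Slot F N (FluctV N) p.K (settingOfRecord₁₂ F N (θ.liveRepin F N) p) (θ.Rz p.K) (WtOfRecord₁₂ F N (θ.liveRepin F N) p) s (t s) (Ek s)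
                    (UbgOfRecord₁₂ F N (θ.liveRepin F N) p (k + 1) s) V))) :
    ∀ k, k ≤ p.K → SLaw₁₂ F N (θ.liveRepin F N) p k :=
  sLaw₁₂_all_liveRepin_of_thmP245Live F N θ p h hθ hκ hE₀ hB₀ (fun k _ => gOfRecord₁₀_succ_nonneg F N θ.toStage9Params p k) hT

variable (ζ : ZetaOfRecord F N numerics7OfRecord₁₂ 1) (Rz : (K : ℕ) → Sect2.Residual (F.P K) (MatA N)) (Zt : (K : ℕ) → TkResidualW F N (FluctV N) K)

/-- **★ THE 𝐑-LEAF OF RECORD AT `θ₀ˡⁱᵛᵉ` FROM THE PROVISOS ALONE** (admissibility, signs and `0 ≤ g_{k+1}` all discharged): `Provisos₁₂ θ₀ˡⁱᵛᵉ ⊢ ROpLeaf (VOfRecord₁₂ θ₀ˡⁱᵛᵉ p)`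
— N13's conjunct on the K0′ witness line costs exactly K0′'s own residual. [cite: Balaban1988Convergent, p.244, Thm 2 p.263; Balaban1989LargeFieldI, (0.3) p.176, p.177 (i)–(ii); Balaban1989LargeFieldII, Thm 1 p.355 (not exercised)] -/
theorem rOpLeaf_VOfRecord₁₂_theta12LiveOfRecord_of_provisos (h : (theta12LiveOfRecord F N ζ Rz Zt).Provisos₁₂ F N) :
    ROpLeaf (VOfRecord₁₂ F N (theta12LiveOfRecord F N ζ Rz Zt) p) :=
  rOpLeaf_VOfRecord₁₂_theta12LiveOfRecord F N ζ Rz Zt p h fun k _ =>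
    gOfRecord₁₀_succ_nonneg F N (theta12OfRecord F N ζ Rz Zt).toStage9Params p k

end FreeSign

end Literature.MathematicalPhysics.QuantumFieldTheory.Balaban1983to89.B16RLeafRecord12AtLive

end
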